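import Literature.Analysis.FluidPDE.Tao2016AveragedNS.SplitCascadeZeroScaleSetup
import Literature.Analysis.FluidPDE.TaoCascadeZeroScaleCritical
import Mathlib.Analysis.Complex.ExponentialBounds
import HarnessLib

/-!
# The split Prop. 6.5, §6.7: the critical time `t_c` and the bounds up to it (port of `TaoCascadeZeroScaleCritical`)

T. Tao, *Finite time blowup for an averaged three-dimensional Navier–Stokes equation*,
J. Amer. Math. Soc. 29 (2016), 601–674 = arXiv:1402.0290v3, §6.7 (6.145)–(6.159) and the definition of
`t_c`. HONEST FRAMING: statements about the SPLIT cascade model system; nothing here proves the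
split Prop. 6.5 and nothing here concerns the true Navier–Stokes equations.

Split counterpart of `TaoCascadeZeroScaleCritical.lean`: the setting `Setting` (= the split
`Context` of `SplitCascadeZeroScaleSetup.lean` + Tao's parameter `Regime`, reused) and the whole
`t_c` analysis, VERBATIM — every lemma here consumes only the `Context` API, whose split version has
the tree's exact statements (the asymmetry having been absorbed into `C₁(1+ε₀)^{-n₀/2}` by the master
smallness of the setting). The single proof that changes is `Setting.F_negOne_le_tc`, which reads
the raw energy inequality at scale `-1`: the two-way pump from scale `-2` is bounded by the same
energies, and the absorbed asymmetry `+C₁(1+ε₀)^{-n₀/2}` fits in the slack `(1+ε₀)^{-5/2} ≤ 1 - ε₀/4`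
of the printed `8K⁻¹⁴`. Tao's `Regime`, `sumSq`, `SmallC`, `tc` and the `h`-free facts are reused.

## References

* T. Tao, J. Amer. Math. Soc. 29 (2016), 601–674 = arXiv:1402.0290v3, §6.1 (parameter hierarchy),
  §6.7 (6.145)–(6.159) and the definition of `t_c`. [`Tao2016AveragedNS`]
-/

noncomputable section

open Set MeasureTheory intervalIntegral Filter Topology

namespace Literature.Analysis.FluidPDE

namespace Tao2016AveragedNS

open TaoCascade hiding ExitTrichotomy
open TaoCascade.ZeroScale hiding Context Setting

namespace ZeroScale

/-! ## The setting of §6.7: hypotheses and parameter regime together -/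

/-- The hypotheses of §6.7 (`Context`) together with the parameter regime (`Regime`). [cite: Tao2016AveragedNS, §6.7] -/
structure Setting (ε₀ K ε C₁ C₂ C₃ C₄ C₅ : ℝ) (n₀ N : ℤ) (ηp : ℤ → ℝ) (βp : ℕ → ℝ) (τ : ℤ → ℝ)
    (Y : Fin 4 → ℤ → ℝ → ℝ) (W : Fin 3 → ℤ → ℝ → ℝ) (F : ℤ → ℝ → ℝ) (T ζ : ℝ) : Prop
    extends Context ε₀ K ε C₁ C₂ C₃ C₄ C₅ n₀ N ηp βp τ Y W F T ζ, Regime ε₀ K ε C₁ C₂ C₄ C₅ n₀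

section Transition

variable {ε₀ K ε C₁ C₂ C₃ C₄ C₅ : ℝ} {n₀ N : ℤ} {ηp : ℤ → ℝ} {βp : ℕ → ℝ} {τ : ℤ → ℝ}
  {Y : Fin 4 → ℤ → ℝ → ℝ} {W : Fin 3 → ℤ → ℝ → ℝ}
  {F : ℤ → ℝ → ℝ} {T ζ : ℝ}

/-- `ρ := C₁ (1+ε₀)^{-n₀/2} ≤ ε⁴ exp(-10 K¹⁰)`. [cite: Tao2016AveragedNS, §6.7] -/
theorem Setting.ρ_le (hs : Setting ε₀ K ε C₁ C₂ C₃ C₄ C₅ n₀ N ηp βp τ Y W F T ζ) :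
    C₁ * (1 + ε₀) ^ (-(n₀ : ℝ) / 2) ≤ ε ^ 4 * Real.exp (-10 * K ^ 10) :=
  hs.C_late hs.ε₀_pos hs.ε_pos hs.C₁_nn hs.C₂_nn hs.C₅_nn hs.C₁_nn
    (by linarith [hs.C₂_nn, hs.C₅_nn])

/-- `C₁ (1+ε₀)^{-n₀/2} ≤ ε`. [cite: Tao2016AveragedNS, §6.7] -/
theorem Setting.ρ_le_ε (hs : Setting ε₀ K ε C₁ C₂ C₃ C₄ C₅ n₀ N ηp βp τ Y W F T ζ) :
    C₁ * (1 + ε₀) ^ (-(n₀ : ℝ) / 2) ≤ ε :=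
  hs.ρ_le.trans (hs.late_le_ε hs.ε_pos)

/-- `ε ≤ K⁻¹⁰⁰`. [cite: Tao2016AveragedNS, §6.7] -/
theorem Setting.ε_le_K100 (hs : Setting ε₀ K ε C₁ C₂ C₃ C₄ C₅ n₀ N ηp βp τ Y W F T ζ) :
    ε ≤ (K ^ 100)⁻¹ := hs.toRegime.ε_le_K100 hs.ε_pos

/-- **The derivative of `S = a₀² + b₀² + c₀² + d₀² + a₁²`** (for (6.146)): on `[0, T]`,
`|∂ₜS| ≤ 13 K⁻⁹`. [cite: Tao2016AveragedNS, §6.7 before (6.146)] -/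
theorem Setting.dS_le (hs : Setting ε₀ K ε C₁ C₂ C₃ C₄ C₅ n₀ N ηp βp τ Y W F T ζ) {t : ℝ}
    (ht : t ∈ Icc 0 T) :
    |2 * (Y 0 0 t * dY (τ (n₀ - N)) Y 0 0 t + Y 1 0 t * dY (τ (n₀ - N)) Y 1 0 t +
        Y 2 0 t * dY (τ (n₀ - N)) Y 2 0 t + Y 3 0 t * dY (τ (n₀ - N)) Y 3 0 t +
        Y 0 1 t * dY (τ (n₀ - N)) Y 0 1 t)| ≤ 13 * (K ^ 9)⁻¹ := by
  have hra := hs.da_zero ht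
  have hrb := hs.db_zero ht
  have hrc := hs.dc_zero ht
  have hrd := hs.dd_zero ht
  have hr1 := hs.da_one ht
  set a := Y 0 0 t; set b := Y 1 0 t; set c := Y 2 0 t; set d := Y 3 0 t; set a₁ := Y 0 1 t
  set Da := dY (τ (n₀ - N)) Y 0 0 t; set Db := dY (τ (n₀ - N)) Y 1 0 t
  set Dc := dY (τ (n₀ - N)) Y 2 0 t; set Dd := dY (τ (n₀ - N)) Y 3 0 t
  set D1 := dY (τ (n₀ - N)) Y 0 1 t
  set ρ := C₁ * (1 + ε₀) ^ (-(n₀ : ℝ) / 2)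
  set q52 := (1 + ε₀) ^ ((5 : ℝ) / 2)
  -- residuals
  set ra := Da + (ε ^ 2)⁻¹ * c * d
  set rb := Db - (ε * a ^ 2 - ε⁻¹ * K ^ 10 * c ^ 2)
  set rc := Dc - (ε ^ 2 * Real.exp (-K ^ 10) * a ^ 2 + ε⁻¹ * K ^ 10 * b * c)
  set rd := Dd - ((ε ^ 2)⁻¹ * c * a - q52 * K * d * a₁)
  set r1 := D1 - q52 * K * d ^ 2
  have key : 2 * (a * Da + b * Db + c * Dc + d * Dd + a₁ * D1) =
      2 * (a * ra + b * rb + c * rc + d * rd + a₁ * r1 + ε * a ^ 2 * b +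
        ε ^ 2 * Real.exp (-K ^ 10) * a ^ 2 * c) := by
    simp only [ra, rb, rc, rd, r1]; ring
  rw [key]
  -- sizes
  have ha := hs.abs_Y_zero_le 0 ht
  have hb := hs.abs_Y_zero_le 1 ht
  have hc := hs.abs_Y_zero_le 2 ht
  have hd := hs.abs_Y_zero_le 3 ht
  have ha1 := hs.abs_Y_one_le 0 ht
  have ha2 := hs.sq_Y_zero_le 0 ht
  have hK := hs.K_pos
  have hε := hs.ε_pos
  have hεK := hs.ε_le_K100
  have hρε := hs.ρ_le_ε
  have hρ0 : 0 ≤ ρ := mul_nonneg hs.C₁_nn (Real.rpow_nonneg hs.q_pos.le _)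
  have hF1 := hs.F_negOne_le ht
  have hC₄ := hs.C₄_nn
  have hC₄K := hs.C₄_le
  have hexph := hs.exp_half_le
  have hexp0 : 0 ≤ Real.exp (-K ^ 10 / 2) := (Real.exp_pos _).le
  have hexp1 : Real.exp (-K ^ 10) ≤ 1 := by
    rw [Real.exp_le_one_iff]; have := pow_nonneg hK.le 10; linarith
  have hK100_9 : (K ^ 100)⁻¹ ≤ (K ^ 10)⁻¹ := hs.inv_pow_anti (by norm_num)
  have hK10_9 : (K ^ 10)⁻¹ ≤ 1 / 10 ^ 6 * (K ^ 9)⁻¹ := hs.inv_pow_succ_le 9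
  have hK9 : 0 < (K ^ 9)⁻¹ := by positivity
  have hK10 : 0 < (K ^ 10)⁻¹ := by positivity
  -- |ra| ≤ 5ε + 4 K⁻⁹ + ρ
  have hra' : |ra| ≤ 5 * ε + 4 * (K ^ 9)⁻¹ + ρ := by
    have : 2 * K * F (-1) t ≤ 4 * (K ^ 9)⁻¹ := by
      calc 2 * K * F (-1) t ≤ 2 * K * (2 * (K ^ 10)⁻¹) := by gcongr
        _ = 4 * (K ^ 9)⁻¹ := by field_simp; ring
    linarith
  -- |r1| ≤ 16 C₄ ε² (3/2) + 4 C₄ e^{-K¹⁰/2} K⁻¹⁰ + 4ρ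
  have hr1' : |r1| ≤ 24 * (K * ε ^ 2) + 4 * (K * Real.exp (-K ^ 10 / 2) * (K ^ 10)⁻¹) + 4 * ρ := by
    have e1 : 16 * C₄ * ε ^ 2 * |a₁| ≤ 16 * K * ε ^ 2 * (3 / 2) := by gcongr
    have e2 : 4 * C₄ * Real.exp (-K ^ 10 / 2) * (K ^ 10)⁻¹ ≤
        4 * K * Real.exp (-K ^ 10 / 2) * (K ^ 10)⁻¹ := by gcongr
    have h := hr1
    simp only [ρ]
    linarith
  -- each product
  have p1 : |a * ra| ≤ 3 / 2 * (5 * ε + 4 * (K ^ 9)⁻¹ + ρ) := by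
    rw [abs_mul]; exact mul_le_mul ha hra' (abs_nonneg _) (by norm_num)
  have p2 : |b * rb| ≤ 3 / 2 * ρ := by
    rw [abs_mul]; exact mul_le_mul hb hrb (abs_nonneg _) (by norm_num)
  have p3 : |c * rc| ≤ 3 / 2 * ρ := by
    rw [abs_mul]; exact mul_le_mul hc hrc (abs_nonneg _) (by norm_num)
  have p4 : |d * rd| ≤ 3 / 2 * ρ := by
    rw [abs_mul]; exact mul_le_mul hd hrd (abs_nonneg _) (by norm_num)
  have p5 : |a₁ * r1| ≤
      3 / 2 * (24 * (K * ε ^ 2) + 4 * (K * Real.exp (-K ^ 10 / 2) * (K ^ 10)⁻¹) + 4 * ρ) := by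
    rw [abs_mul]; exact mul_le_mul ha1 hr1' (abs_nonneg _) (by norm_num)
  have p6 : |ε * a ^ 2 * b| ≤ 3 * ε := by
    rw [abs_mul, abs_mul, abs_of_pos hε, abs_of_nonneg (sq_nonneg a)]
    calc ε * a ^ 2 * |b| ≤ ε * 2 * (3 / 2) := by gcongr
      _ = 3 * ε := by ring
  have p7 : |ε ^ 2 * Real.exp (-K ^ 10) * a ^ 2 * c| ≤ 3 * ε := by
    rw [abs_mul, abs_mul, abs_mul, abs_of_pos (by positivity : (0:ℝ) < ε ^ 2),
      abs_of_pos (Real.exp_pos _), abs_of_nonneg (sq_nonneg a)]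
    have hε1 : ε ^ 2 ≤ ε := by
      have := hs.ε_le_one hε; nlinarith
    calc ε ^ 2 * Real.exp (-K ^ 10) * a ^ 2 * |c| ≤ ε * 1 * 2 * (3 / 2) := by gcongr
      _ = 3 * ε := by ring
  -- tiny terms
  have t1 : K * ε ^ 2 ≤ (K ^ 10)⁻¹ := by
    have hε1 := hs.ε_le_one hε
    calc K * ε ^ 2 ≤ K * ((K ^ 100)⁻¹ * 1) := by
          rw [pow_two]; gcongr
      _ = K * (K ^ 100)⁻¹ := by ring
      _ ≤ (K ^ 99)⁻¹ := hs.mul_inv_pow_succ_le le_rfl 99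
      _ ≤ (K ^ 10)⁻¹ := hs.inv_pow_anti (by norm_num)
  have t2 : K * Real.exp (-K ^ 10 / 2) * (K ^ 10)⁻¹ ≤ (K ^ 10)⁻¹ := by
    have : K * Real.exp (-K ^ 10 / 2) ≤ 1 := by
      calc K * Real.exp (-K ^ 10 / 2) ≤ K * (K ^ 100)⁻¹ := by gcongr
        _ ≤ (K ^ 99)⁻¹ := hs.mul_inv_pow_succ_le le_rfl 99
        _ ≤ (K ^ 0)⁻¹ := hs.inv_pow_anti (by norm_num)
        _ = 1 := by simp
    calc K * Real.exp (-K ^ 10 / 2) * (K ^ 10)⁻¹ ≤ 1 * (K ^ 10)⁻¹ := by gcongr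
      _ = _ := one_mul _
  have t3 : ε ≤ (K ^ 10)⁻¹ := hεK.trans hK100_9
  have t4 : ρ ≤ (K ^ 10)⁻¹ := hρε.trans t3
  rw [abs_mul, abs_two]
  have hsum := abs_add_le (a * ra + b * rb + c * rc + d * rd + a₁ * r1 + ε * a ^ 2 * b)
    (ε ^ 2 * Real.exp (-K ^ 10) * a ^ 2 * c)
  have hsum2 := abs_add_le (a * ra + b * rb + c * rc + d * rd + a₁ * r1) (ε * a ^ 2 * b)
  have hsum3 := abs_add_le (a * ra + b * rb + c * rc + d * rd) (a₁ * r1)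
  have hsum4 := abs_add_le (a * ra + b * rb + c * rc) (d * rd)
  have hsum5 := abs_add_three (a * ra) (b * rb) (c * rc)
  linarith

/-- The right derivative of `S = a₀² + b₀² + c₀² + d₀² + a₁²`. [cite: Tao2016AveragedNS, §6.7] -/
theorem Setting.hasDerivWithinAt_sumSq (hs : Setting ε₀ K ε C₁ C₂ C₃ C₄ C₅ n₀ N ηp βp τ Y W F T ζ) {t : ℝ}
    (ht : τ (n₀ - N) ≤ t) :
    HasDerivWithinAt (sumSq Y)
      (2 * (Y 0 0 t * dY (τ (n₀ - N)) Y 0 0 t + Y 1 0 t * dY (τ (n₀ - N)) Y 1 0 t +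
        Y 2 0 t * dY (τ (n₀ - N)) Y 2 0 t + Y 3 0 t * dY (τ (n₀ - N)) Y 3 0 t +
        Y 0 1 t * dY (τ (n₀ - N)) Y 0 1 t)) (Ici t) t := by
  have h00 := (hs.hasDerivWithinAt_Y 0 0 ht).pow 2
  have h10 := (hs.hasDerivWithinAt_Y 1 0 ht).pow 2
  have h20 := (hs.hasDerivWithinAt_Y 2 0 ht).pow 2
  have h30 := (hs.hasDerivWithinAt_Y 3 0 ht).pow 2
  have h01 := (hs.hasDerivWithinAt_Y 0 1 ht).pow 2
  have := (((h00.add h10).add h20).add h30).add h01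
  refine this.congr_deriv ?_
  norm_num; ring

/-- `S` is continuous. [cite: Tao2016AveragedNS, §6.7] -/
theorem Setting.continuousOn_sumSq (hs : Setting ε₀ K ε C₁ C₂ C₃ C₄ C₅ n₀ N ηp βp τ Y W F T ζ) {a b : ℝ}
    (ha : τ (n₀ - N) ≤ a) : ContinuousOn (sumSq Y) (Icc a b) := by
  unfold sumSq
  have h := fun i k => (hs.continuousOn_Y i k (b := b) ha).pow 2
  exact ((((h 0 0).add (h 1 0)).add (h 2 0)).add (h 3 0)).add (h 0 1)

/-- **Lemma 6.8** `Ẽ₁(0) ≤ K⁻³⁰` (from (6.66) at `k = 0` if `N > n₀`, from (6.50) if `N = n₀`).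
[cite: Tao2016AveragedNS, §6.5 Lemma 6.8] -/
theorem Setting.F_one_zero_le (hs : Setting ε₀ K ε C₁ C₂ C₃ C₄ C₅ n₀ N ηp βp τ Y W F T ζ) :
    F 1 0 ≤ (K ^ 30)⁻¹ := by
  have hK : 0 ≤ (K ^ 30)⁻¹ := by have := hs.K_pos; positivity
  rcases lt_or_eq_of_le hs.le_N with hN | hN
  · have hτ : τ (0 - 1) ≤ 0 := by
      have := hs.hyp.tau_lt 0 (by linarith) le_rfl
      rw [hs.hyp.tau_zero] at this; exact this.le
    have h := hs.hyp.en_after 0 (by linarith) le_rfl 1 le_rfl 0 ⟨hτ, by rw [hs.hyp.tau_zero]⟩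
    have hq : (1 + ε₀) ^ (-(10 : ℝ) * ((1 : ℕ) : ℝ) + |((0 : ℤ) : ℝ) - 1| / 50) ≤ 1 :=
      hs.q_rpow_le_one (by norm_num)
    calc F 1 0 = F (0 + (1 : ℕ)) 0 := by norm_num
      _ ≤ (K ^ 30)⁻¹ * (1 + ε₀) ^ (-(10 : ℝ) * ((1 : ℕ) : ℝ) + |((0 : ℤ) : ℝ) - 1| / 50) := h
      _ ≤ (K ^ 30)⁻¹ * 1 := by gcongr
      _ = _ := mul_one _
  · have h := hs.hyp.init_F 1 (by omega)
    rw [show n₀ - N = 0 by omega, hs.hyp.tau_zero] at h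
    rw [h]; exact hK

/-- `S(0) = 1 + O(K⁻²⁰)`: precisely `0 ≤ S(0) - 1 ≤ 3 K⁻²⁰`. [cite: Tao2016AveragedNS, §6.7] -/
theorem Setting.sumSq_zero (hs : Setting ε₀ K ε C₁ C₂ C₃ C₄ C₅ n₀ N ηp βp τ Y W F T ζ) :
    0 ≤ sumSq Y 0 - 1 ∧ sumSq Y 0 - 1 ≤ 3 * (K ^ 20)⁻¹ := by
  have ha := hs.hyp.a_eq
  have hb := hs.hyp.b_abs_le
  have hc := hs.hyp.c_abs_le
  have hd := hs.hyp.d_abs_le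
  have ha1 := hs.sq_Y_le 0 1 hs.τ₀_le
  have hF1 := hs.F_one_zero_le
  have hK := hs.K_pos
  have hε := hs.ε_pos
  have hεK := hs.ε_le_K100
  have hK20 : 0 < (K ^ 20)⁻¹ := by positivity
  have hK30 : (K ^ 30)⁻¹ ≤ (K ^ 20)⁻¹ := hs.inv_pow_anti (by norm_num)
  have hK100 : (K ^ 100)⁻¹ ≤ (K ^ 20)⁻¹ := hs.inv_pow_anti (by norm_num)
  have hγ : 1 / 10 ^ 5 * Real.exp (-K ^ 10 / 2) ≤ 1 := by
    have : Real.exp (-K ^ 10 / 2) ≤ 1 := by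
      rw [Real.exp_le_one_iff]; have := pow_nonneg hK.le 10; linarith
    linarith [Real.exp_pos (-K ^ 10 / 2)]
  have hε1 := hs.ε_le_one hε
  -- squares of the small initial modes
  have hhalf : (K ^ 20)⁻¹ ≤ 1 / 2 := hs.inv_K_pow_le_half (by norm_num)
  have hb2 : Y 1 0 0 ^ 2 ≤ 1 / 2 * (K ^ 20)⁻¹ := by
    have h1 : |Y 1 0 0| ≤ (K ^ 20)⁻¹ := by
      calc |Y 1 0 0| ≤ 1 / 10 ^ 5 * ε := hb
        _ ≤ 1 * (K ^ 100)⁻¹ := by gcongr; norm_num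
        _ ≤ (K ^ 20)⁻¹ := by rw [one_mul]; exact hK100
    have h2 := pow_le_pow_left₀ (abs_nonneg _) h1 2
    rw [sq_abs] at h2
    calc Y 1 0 0 ^ 2 ≤ (K ^ 20)⁻¹ ^ 2 := h2
      _ = (K ^ 20)⁻¹ * (K ^ 20)⁻¹ := sq _
      _ ≤ 1 / 2 * (K ^ 20)⁻¹ := by gcongr
  have hc2 : Y 2 0 0 ^ 2 ≤ 1 / 2 * (K ^ 20)⁻¹ := by
    have h1 : |Y 2 0 0| ≤ (K ^ 20)⁻¹ := by
      calc |Y 2 0 0| ≤ 1 / 10 ^ 5 * Real.exp (-K ^ 10 / 2) * ε ^ 2 := hc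
        _ ≤ 1 * ε ^ 2 := by gcongr
        _ ≤ ε := by rw [one_mul]; nlinarith
        _ ≤ (K ^ 20)⁻¹ := hεK.trans hK100
    have h2 := pow_le_pow_left₀ (abs_nonneg _) h1 2
    rw [sq_abs] at h2
    calc Y 2 0 0 ^ 2 ≤ (K ^ 20)⁻¹ ^ 2 := h2
      _ = (K ^ 20)⁻¹ * (K ^ 20)⁻¹ := sq _
      _ ≤ 1 / 2 * (K ^ 20)⁻¹ := by gcongr
  have hd2 : Y 3 0 0 ^ 2 ≤ (K ^ 20)⁻¹ := by
    have h2 := pow_le_pow_left₀ (abs_nonneg _) hd 2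
    rw [sq_abs] at h2
    calc Y 3 0 0 ^ 2 ≤ (K ^ 10)⁻¹ ^ 2 := h2
      _ = (K ^ 20)⁻¹ := by rw [← inv_pow, ← pow_mul, inv_pow]
  have ha12 : Y 0 1 0 ^ 2 ≤ 2 / 10 ^ 6 * (K ^ 20)⁻¹ := by
    have h21 : (K ^ 30)⁻¹ ≤ (K ^ 21)⁻¹ := hs.inv_pow_anti (by norm_num)
    have h20 : (K ^ 21)⁻¹ ≤ 1 / 10 ^ 6 * (K ^ 20)⁻¹ := hs.inv_pow_succ_le 20
    linarith
  unfold sumSq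
  rw [ha]
  constructor
  · nlinarith [sq_nonneg (Y 1 0 0), sq_nonneg (Y 2 0 0), sq_nonneg (Y 3 0 0),
      sq_nonneg (Y 0 1 0)]
  · linarith

/-- **(6.146)**: `a₀² + b₀² + c₀² + d₀² + a₁² = 1 + O(K⁻¹)` on `[0, T]`; precisely
`|S(t) - 1| ≤ K⁻⁸`. [cite: Tao2016AveragedNS, §6.7 (6.146)] -/
theorem Setting.sumSq_bound (hs : Setting ε₀ K ε C₁ C₂ C₃ C₄ C₅ n₀ N ηp βp τ Y W F T ζ) {t : ℝ}
    (ht : t ∈ Icc 0 T) : |sumSq Y t - 1| ≤ (K ^ 8)⁻¹ := by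
  have hderiv := abs_sub_le_mul_of_abs_deriv_le (hs.continuousOn_sumSq (b := T) hs.τ₀_le)
    (fun x hx => hs.hasDerivWithinAt_sumSq (hs.τ₀_le.trans hx.1))
    (fun x hx => hs.dS_le (Ico_subset_Icc_self hx)) ht
  obtain ⟨h0, h1⟩ := hs.sumSq_zero
  have hK := hs.K_pos
  have hT := hs.T_le
  have h9 : (K ^ 9)⁻¹ ≤ 1 / 10 ^ 6 * (K ^ 8)⁻¹ := hs.inv_pow_succ_le 8
  have h20 : (K ^ 20)⁻¹ ≤ (K ^ 9)⁻¹ := hs.inv_pow_anti (by norm_num)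
  have h8 : 0 < (K ^ 8)⁻¹ := by positivity
  have ht100 : t - 0 ≤ 100 := by linarith [ht.2]
  have : 13 * (K ^ 9)⁻¹ * (t - 0) ≤ 13 * (K ^ 9)⁻¹ * 100 := by gcongr
  rw [abs_le] at hderiv ⊢
  constructor <;> nlinarith

/-- `a₀² ≤ 1 + K⁻⁸` on `[0, T]` (from (6.146)). [cite: Tao2016AveragedNS, §6.7] -/
theorem Setting.sq_a_zero_le (hs : Setting ε₀ K ε C₁ C₂ C₃ C₄ C₅ n₀ N ηp βp τ Y W F T ζ) {t : ℝ}
    (ht : t ∈ Icc 0 T) : Y 0 0 t ^ 2 ≤ 1 + (K ^ 8)⁻¹ := by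
  have h := hs.sumSq_bound ht
  rw [abs_le] at h
  unfold sumSq at h
  nlinarith [sq_nonneg (Y 1 0 t), sq_nonneg (Y 2 0 t), sq_nonneg (Y 3 0 t), sq_nonneg (Y 0 1 t)]

/-- **(6.147)**: `√(b₀² + c₀²)(t) ≤ (10⁻⁵ + t + K⁻⁷) ε` on `[0, T]` (the printed
`(10⁻⁵ + t + O(K⁻¹)) ε`). [cite: Tao2016AveragedNS, §6.7 (6.147)] -/
theorem Setting.sqrt_bc_le (hs : Setting ε₀ K ε C₁ C₂ C₃ C₄ C₅ n₀ N ηp βp τ Y W F T ζ) {t : ℝ}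
    (ht : t ∈ Icc 0 T) :
    Real.sqrt (Y 1 0 t ^ 2 + Y 2 0 t ^ 2) ≤ (1 / 10 ^ 5 + t + (K ^ 7)⁻¹) * ε := by
  have hK := hs.K_pos
  have hε := hs.ε_pos
  have hε1 := hs.ε_le_one hε
  have hεK := hs.ε_le_K100
  have hρε := hs.ρ_le
  have hK8 : 0 < (K ^ 8)⁻¹ := by positivity
  set M : ℝ := ε * (1 + 2 * (K ^ 8)⁻¹) with hM
  have hM0 : 0 ≤ M := by positivity
  -- the differential inequality
  have hbound : ∀ x ∈ Ico 0 T,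
      Y 1 0 x * dY (τ (n₀ - N)) Y 1 0 x + Y 2 0 x * dY (τ (n₀ - N)) Y 2 0 x ≤
        M * Real.sqrt (Y 1 0 x ^ 2 + Y 2 0 x ^ 2) + 0 * (Y 1 0 x ^ 2 + Y 2 0 x ^ 2) := by
    intro x hx
    have hx' : x ∈ Icc 0 T := Ico_subset_Icc_self hx
    have hrb := hs.db_zero hx'
    have hrc := hs.dc_zero hx'
    have ha2 := hs.sq_a_zero_le hx'
    set a := Y 0 0 x; set b := Y 1 0 x; set c := Y 2 0 x
    set Db := dY (τ (n₀ - N)) Y 1 0 x; set Dc := dY (τ (n₀ - N)) Y 2 0 x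
    set ρ := C₁ * (1 + ε₀) ^ (-(n₀ : ℝ) / 2)
    set rb := Db - (ε * a ^ 2 - ε⁻¹ * K ^ 10 * c ^ 2)
    set rc := Dc - (ε ^ 2 * Real.exp (-K ^ 10) * a ^ 2 + ε⁻¹ * K ^ 10 * b * c)
    have key : b * Db + c * Dc =
        b * rb + c * rc + ε * a ^ 2 * b + ε ^ 2 * Real.exp (-K ^ 10) * a ^ 2 * c := by
      simp only [rb, rc]; ring
    rw [key, zero_mul, add_zero]
    set r := Real.sqrt (b ^ 2 + c ^ 2)
    have hbr : |b| ≤ r := Real.abs_le_sqrt (by nlinarith)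
    have hcr : |c| ≤ r := Real.abs_le_sqrt (by nlinarith)
    have hr0 : 0 ≤ r := Real.sqrt_nonneg _
    have hρ0 : 0 ≤ ρ := mul_nonneg hs.C₁_nn (Real.rpow_nonneg hs.q_pos.le _)
    have hexp1 : Real.exp (-K ^ 10) ≤ 1 := by
      rw [Real.exp_le_one_iff]; have := pow_nonneg hK.le 10; linarith
    have hexp0 := Real.exp_pos (-K ^ 10)
    -- bound each term by r * (…)
    have e1 : b * rb ≤ r * ρ := by
      calc b * rb ≤ |b * rb| := le_abs_self _
        _ = |b| * |rb| := abs_mul _ _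
        _ ≤ r * ρ := mul_le_mul hbr hrb (abs_nonneg _) hr0
    have e2 : c * rc ≤ r * ρ := by
      calc c * rc ≤ |c * rc| := le_abs_self _
        _ = |c| * |rc| := abs_mul _ _
        _ ≤ r * ρ := mul_le_mul hcr hrc (abs_nonneg _) hr0
    have e3 : ε * a ^ 2 * b ≤ r * (ε * (1 + (K ^ 8)⁻¹)) := by
      calc ε * a ^ 2 * b ≤ |ε * a ^ 2 * b| := le_abs_self _
        _ = ε * a ^ 2 * |b| := by rw [abs_mul, abs_mul, abs_of_pos hε, abs_of_nonneg (sq_nonneg a)]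
        _ ≤ ε * (1 + (K ^ 8)⁻¹) * r := by gcongr
        _ = r * (ε * (1 + (K ^ 8)⁻¹)) := by ring
    have e4 : ε ^ 2 * Real.exp (-K ^ 10) * a ^ 2 * c ≤ r * (ε ^ 2 * (1 + (K ^ 8)⁻¹)) := by
      calc ε ^ 2 * Real.exp (-K ^ 10) * a ^ 2 * c ≤ |ε ^ 2 * Real.exp (-K ^ 10) * a ^ 2 * c| :=
            le_abs_self _
        _ = ε ^ 2 * Real.exp (-K ^ 10) * a ^ 2 * |c| := by
            rw [abs_mul, abs_mul, abs_mul, abs_of_pos (by positivity : (0:ℝ) < ε ^ 2),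
              abs_of_pos hexp0, abs_of_nonneg (sq_nonneg a)]
        _ ≤ ε ^ 2 * 1 * (1 + (K ^ 8)⁻¹) * r := by gcongr
        _ = r * (ε ^ 2 * (1 + (K ^ 8)⁻¹)) := by ring
    -- sum of the coefficients ≤ M
    have hcoef : ρ + ρ + ε * (1 + (K ^ 8)⁻¹) + ε ^ 2 * (1 + (K ^ 8)⁻¹) ≤ M := by
      have h1 : ρ ≤ ε ^ 4 * Real.exp (-10 * K ^ 10) := hρε
      have h2 : ε ^ 4 * Real.exp (-10 * K ^ 10) ≤ ε ^ 4 := by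
        have : Real.exp (-10 * K ^ 10) ≤ 1 := by
          rw [Real.exp_le_one_iff]; have := pow_nonneg hK.le 10; linarith
        exact mul_le_of_le_one_right (by positivity) this
      have h3 : ε ^ 4 ≤ ε ^ 2 := pow_le_pow_of_le_one hε.le hε1 (by norm_num)
      have h4 : ε ^ 2 ≤ ε * (K ^ 100)⁻¹ := by rw [pow_two]; gcongr
      have h5 : (K ^ 100)⁻¹ ≤ 1 / 10 ^ 6 * (K ^ 8)⁻¹ :=
        (hs.inv_pow_anti (by norm_num : 9 ≤ 100)).trans (hs.inv_pow_succ_le 8)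
      have h6 : (K ^ 8)⁻¹ ≤ 1 / 2 := hs.inv_K_pow_le_half (by norm_num)
      have hw : ε ^ 2 ≤ 1 / 10 ^ 6 * (ε * (K ^ 8)⁻¹) := by
        calc ε ^ 2 ≤ ε * (K ^ 100)⁻¹ := h4
          _ ≤ ε * (1 / 10 ^ 6 * (K ^ 8)⁻¹) := by gcongr
          _ = _ := by ring
      have hQ : ε ^ 2 * (K ^ 8)⁻¹ ≤ ε ^ 2 * (1 / 2) := mul_le_mul_of_nonneg_left h6 (sq_nonneg ε)
      have hP : 0 ≤ ε * (K ^ 8)⁻¹ := by positivity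
      simp only [hM]
      nlinarith
    nlinarith
  have hmain := sqrt_sq_add_sq_le_of_deriv (hs.continuousOn_Y 1 0 (b := T) hs.τ₀_le)
    (hs.continuousOn_Y 2 0 (b := T) hs.τ₀_le)
    (fun x hx => hs.hasDerivWithinAt_Y 1 0 (hs.τ₀_le.trans hx.1))
    (fun x hx => hs.hasDerivWithinAt_Y 2 0 (hs.τ₀_le.trans hx.1)) hM0 le_rfl hbound ht
  rw [zero_mul, Real.exp_zero, one_mul, sub_zero] at hmain
  -- the initial value
  have hinit : Real.sqrt (Y 1 0 0 ^ 2 + Y 2 0 0 ^ 2) ≤ (1 / 10 ^ 5 + (K ^ 8)⁻¹) * ε := by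
    have hb := hs.hyp.b_abs_le
    have hc := hs.hyp.c_abs_le
    have hc' : |Y 2 0 0| ≤ (K ^ 8)⁻¹ * ε := by
      have hγ1 : 1 / 10 ^ 5 * Real.exp (-K ^ 10 / 2) ≤ 1 := by
        have : Real.exp (-K ^ 10 / 2) ≤ 1 := by
          rw [Real.exp_le_one_iff]; have := pow_nonneg hK.le 10; linarith
        linarith [Real.exp_pos (-K ^ 10 / 2)]
      have h8 : (K ^ 100)⁻¹ ≤ (K ^ 8)⁻¹ := hs.inv_pow_anti (by norm_num)
      calc |Y 2 0 0| ≤ 1 / 10 ^ 5 * Real.exp (-K ^ 10 / 2) * ε ^ 2 := hc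
        _ ≤ 1 * ε ^ 2 := by gcongr
        _ = ε * ε := by ring
        _ ≤ (K ^ 100)⁻¹ * ε := by gcongr
        _ ≤ (K ^ 8)⁻¹ * ε := by gcongr
    rw [Real.sqrt_le_iff]
    refine ⟨by positivity, ?_⟩
    have hb0 := abs_nonneg (Y 1 0 0)
    have hc0 := abs_nonneg (Y 2 0 0)
    calc Y 1 0 0 ^ 2 + Y 2 0 0 ^ 2 = |Y 1 0 0| ^ 2 + |Y 2 0 0| ^ 2 := by rw [sq_abs, sq_abs]
      _ ≤ (|Y 1 0 0| + |Y 2 0 0|) ^ 2 := by nlinarith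
      _ ≤ ((1 / 10 ^ 5 + (K ^ 8)⁻¹) * ε) ^ 2 := by
          apply pow_le_pow_left₀ (by positivity)
          calc |Y 1 0 0| + |Y 2 0 0| ≤ 1 / 10 ^ 5 * ε + (K ^ 8)⁻¹ * ε := add_le_add hb hc'
            _ = _ := by ring
  have ht0 : 0 ≤ t := ht.1
  have ht100 : t ≤ 100 := ht.2.trans hs.T_le
  have hK87 : (K ^ 8)⁻¹ ≤ 1 / 10 ^ 6 * (K ^ 7)⁻¹ := hs.inv_pow_succ_le 7
  have hK7 : 0 < (K ^ 7)⁻¹ := by positivity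
  calc Real.sqrt (Y 1 0 t ^ 2 + Y 2 0 t ^ 2)
      ≤ Real.sqrt (Y 1 0 0 ^ 2 + Y 2 0 0 ^ 2) + M * t := hmain
    _ ≤ (1 / 10 ^ 5 + (K ^ 8)⁻¹) * ε + M * t := by gcongr
    _ = (1 / 10 ^ 5 + t + (K ^ 8)⁻¹ * (1 + 2 * t)) * ε := by simp only [hM]; ring
    _ ≤ (1 / 10 ^ 5 + t + (K ^ 7)⁻¹) * ε := by
        gcongr
        nlinarith

/-- **(6.147)** for `b₀`: `|b₀(t)| ≤ (10⁻⁵ + t + K⁻⁷) ε` on `[0, T]`.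
[cite: Tao2016AveragedNS, §6.7 (6.147)] -/
theorem Setting.abs_b_zero_le (hs : Setting ε₀ K ε C₁ C₂ C₃ C₄ C₅ n₀ N ηp βp τ Y W F T ζ) {t : ℝ}
    (ht : t ∈ Icc 0 T) : |Y 1 0 t| ≤ (1 / 10 ^ 5 + t + (K ^ 7)⁻¹) * ε :=
  (Real.abs_le_sqrt (by nlinarith [sq_nonneg (Y 2 0 t)])).trans (hs.sqrt_bc_le ht)

/-- **(6.147)** for `c₀`: `|c₀(t)| ≤ (10⁻⁵ + t + K⁻⁷) ε` on `[0, T]`.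
[cite: Tao2016AveragedNS, §6.7 (6.147)] -/
theorem Setting.abs_c_zero_le' (hs : Setting ε₀ K ε C₁ C₂ C₃ C₄ C₅ n₀ N ηp βp τ Y W F T ζ) {t : ℝ}
    (ht : t ∈ Icc 0 T) : |Y 2 0 t| ≤ (1 / 10 ^ 5 + t + (K ^ 7)⁻¹) * ε :=
  (Real.abs_le_sqrt (by nlinarith [sq_nonneg (Y 1 0 t)])).trans (hs.sqrt_bc_le ht)

/-- **(6.148)** (with the corrected initial bound (6.56)): on `[0, T]`,
`|c₀(t)| ≤ 10⁻⁴ ε² exp(K¹⁰ t (10⁻⁵ + t + K⁻⁷) - K¹⁰/2)` (printed: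
`≲ ε² exp(K¹⁰(-1/4 + 10⁻⁵ t + t²/2 + O(K⁻¹)))`; by Grönwall from (6.131), (6.147)).
[cite: Tao2016AveragedNS, §6.7 (6.148)] -/
theorem Setting.abs_c_zero_le (hs : Setting ε₀ K ε C₁ C₂ C₃ C₄ C₅ n₀ N ηp βp τ Y W F T ζ) {t : ℝ}
    (ht : t ∈ Icc 0 T) :
    |Y 2 0 t| ≤ 1 / 10 ^ 4 * ε ^ 2 *
      Real.exp (K ^ 10 * (t * (1 / 10 ^ 5 + t + (K ^ 7)⁻¹)) - K ^ 10 / 2) := by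
  have hK := hs.K_pos
  have hε := hs.ε_pos
  have hε1 := hs.ε_le_one hε
  have hεK := hs.ε_le_K100
  have hρ := hs.ρ_le
  have hτ₀ := hs.τ₀_le
  set ρ := C₁ * (1 + ε₀) ^ (-(n₀ : ℝ) / 2) with hρdef
  have hρ0 : 0 ≤ ρ := mul_nonneg hs.C₁_nn (Real.rpow_nonneg hs.q_pos.le _)
  set β : ℝ → ℝ := fun s => ε⁻¹ * K ^ 10 * Y 1 0 s with hβ
  set R : ℝ → ℝ := fun s => ε ^ 2 * Real.exp (-K ^ 10) * Y 0 0 s ^ 2 + ρ with hR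
  have hgc : ContinuousOn (Y 2 0) (Icc 0 T) := hs.continuousOn_Y 2 0 hτ₀
  have hβc : ContinuousOn β (Icc 0 T) := (hs.continuousOn_Y 1 0 hτ₀).const_smul (ε⁻¹ * K ^ 10)
  have hRc : ContinuousOn R (Icc 0 T) :=
    (((hs.continuousOn_Y 0 0 hτ₀).pow 2).const_smul (ε ^ 2 * Real.exp (-K ^ 10))).add
      continuousOn_const
  have hR0 : ∀ s ∈ Icc 0 T, 0 ≤ R s := fun s _ => by
    simp only [hR]; exact add_nonneg (by positivity) hρ0
  have hbound : ∀ s ∈ Ico 0 T, |dY (τ (n₀ - N)) Y 2 0 s - β s * Y 2 0 s| ≤ R s := by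
    intro s hs'
    have h := hs.dc_zero (Ico_subset_Icc_self hs')
    simp only [hβ, hR]
    have key : dY (τ (n₀ - N)) Y 2 0 s - ε⁻¹ * K ^ 10 * Y 1 0 s * Y 2 0 s =
        (dY (τ (n₀ - N)) Y 2 0 s -
          (ε ^ 2 * Real.exp (-K ^ 10) * Y 0 0 s ^ 2 + ε⁻¹ * K ^ 10 * Y 1 0 s * Y 2 0 s)) +
        ε ^ 2 * Real.exp (-K ^ 10) * Y 0 0 s ^ 2 := by ring
    rw [key]
    refine (abs_add_le _ _).trans ?_
    rw [abs_of_nonneg (by positivity : (0:ℝ) ≤ ε ^ 2 * Real.exp (-K ^ 10) * Y 0 0 s ^ 2)]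
    linarith
  have hmain := ODE.abs_le_linearComparison hgc
    (fun s hs' => hs.hasDerivWithinAt_Y 2 0 (hτ₀.trans hs'.1)) hRc hR0 hβc hbound ht
  -- the integral of |β|
  set L := K ^ 10 * (1 / 10 ^ 5 + t + (K ^ 7)⁻¹) with hL
  have hL0 : 0 ≤ L := by
    have : 0 ≤ t := ht.1
    have : 0 < (K ^ 7)⁻¹ := by positivity
    simp only [hL]; positivity
  have hI1 : ∫ s in (0:ℝ)..t, |β s| ≤ L * t := by
    have hle : ∀ s ∈ Icc 0 t, |β s| ≤ L := by
      intro s hs'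
      have hsT : s ∈ Icc 0 T := ⟨hs'.1, hs'.2.trans ht.2⟩
      have hb := hs.abs_b_zero_le hsT
      simp only [hβ, hL]
      rw [abs_mul, abs_of_pos (by positivity : (0:ℝ) < ε⁻¹ * K ^ 10)]
      calc ε⁻¹ * K ^ 10 * |Y 1 0 s| ≤ ε⁻¹ * K ^ 10 * ((1 / 10 ^ 5 + s + (K ^ 7)⁻¹) * ε) := by
            gcongr
        _ = K ^ 10 * (1 / 10 ^ 5 + s + (K ^ 7)⁻¹) := by field_simp
        _ ≤ K ^ 10 * (1 / 10 ^ 5 + t + (K ^ 7)⁻¹) := by gcongr; exact hs'.2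
    have hβi : IntervalIntegrable (fun s => |β s|) volume 0 t :=
      ((hβc.mono (Icc_subset_Icc le_rfl ht.2)).abs).intervalIntegrable_of_Icc ht.1
    calc ∫ s in (0:ℝ)..t, |β s| ≤ ∫ s in (0:ℝ)..t, L :=
          intervalIntegral.integral_mono_on ht.1 hβi intervalIntegrable_const hle
      _ = L * t := by simp [mul_comm]
  -- the integral of R
  have hI2 : ∫ s in (0:ℝ)..t, R s ≤ (2 * ε ^ 2 * Real.exp (-K ^ 10) + ρ) * t := by
    have hle : ∀ s ∈ Icc 0 t, R s ≤ 2 * ε ^ 2 * Real.exp (-K ^ 10) + ρ := by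
      intro s hs'
      have hsT : s ∈ Icc 0 T := ⟨hs'.1, hs'.2.trans ht.2⟩
      have ha := hs.sq_Y_zero_le 0 hsT
      simp only [hR]
      nlinarith [Real.exp_pos (-K ^ 10), sq_nonneg ε, mul_pos (pow_pos hε 2) (Real.exp_pos (-K ^ 10))]
    have hRi : IntervalIntegrable R volume 0 t :=
      (hRc.mono (Icc_subset_Icc le_rfl ht.2)).intervalIntegrable_of_Icc ht.1
    calc ∫ s in (0:ℝ)..t, R s ≤ ∫ s in (0:ℝ)..t, (2 * ε ^ 2 * Real.exp (-K ^ 10) + ρ) :=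
          intervalIntegral.integral_mono_on ht.1 hRi intervalIntegrable_const hle
      _ = (2 * ε ^ 2 * Real.exp (-K ^ 10) + ρ) * t := by simp; ring
  -- the initial value
  have h0 : |Y 2 0 0| ≤ 1 / 10 ^ 5 * Real.exp (-K ^ 10 / 2) * ε ^ 2 := hs.hyp.c_abs_le
  -- assemble: |c₀(t)| ≤ exp(L t) (γ ε² + (2ε²e^{-K¹⁰} + ρ) t)
  have ht100 : t ≤ 100 := ht.2.trans hs.T_le
  have hexpL : Real.exp (∫ s in (0:ℝ)..t, |β s|) ≤ Real.exp (L * t) := Real.exp_le_exp.2 hI1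
  have hsum : |Y 2 0 0| + ∫ s in (0:ℝ)..t, R s ≤
      1 / 10 ^ 4 * ε ^ 2 * Real.exp (-K ^ 10 / 2) := by
    -- `(2ε²e^{-K¹⁰} + ρ) t ≤ 9·10⁻⁵ ε² e^{-K¹⁰/2}`
    have hhalf : Real.exp (-K ^ 10) = Real.exp (-K ^ 10 / 2) * Real.exp (-K ^ 10 / 2) := by
      rw [← Real.exp_add]; congr 1; ring
    have he := hs.exp_half_le
    have he0 := Real.exp_pos (-K ^ 10 / 2)
    have hK100 : (K ^ 100)⁻¹ ≤ 1 / 10 ^ 12 := by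
      have h1 := hs.inv_pow_succ_le 99
      have h2 := hs.inv_pow_succ_le 98
      have h98 : (K ^ 98)⁻¹ ≤ 1 := by
        have := hs.inv_pow_anti (n := 0) (m := 98) (by norm_num); simpa using this
      nlinarith
    set E := Real.exp (-K ^ 10 / 2) with hE
    have hρ' : ρ ≤ ε ^ 2 * E * (K ^ 100)⁻¹ := by
      calc ρ ≤ ε ^ 4 * Real.exp (-10 * K ^ 10) := hρ
        _ = ε ^ 2 * E * (ε ^ 2 * Real.exp (-(19 : ℝ) / 2 * K ^ 10)) := by
            rw [show ε ^ 4 = ε ^ 2 * ε ^ 2 by ring,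
              show (-10 * K ^ 10 : ℝ) = -K ^ 10 / 2 + -(19 : ℝ) / 2 * K ^ 10 by ring, Real.exp_add]
            ring
        _ ≤ ε ^ 2 * E * ((K ^ 100)⁻¹ * 1) := by
            gcongr
            · calc ε ^ 2 ≤ ε := by nlinarith
                _ ≤ _ := hεK
            · rw [Real.exp_le_one_iff]; have := pow_nonneg hK.le 10; nlinarith
        _ = _ := by ring
    rw [hhalf] at hI2
    have hε2E : 0 < ε ^ 2 * E := mul_pos (pow_pos hε 2) he0
    have hbr0 : 0 ≤ 2 * ε ^ 2 * (E * E) + ρ := by positivity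
    have hI2' : ∫ s in (0:ℝ)..t, R s ≤ (2 * ε ^ 2 * (E * E) + ρ) * 100 :=
      hI2.trans (mul_le_mul_of_nonneg_left ht100 hbr0)
    have hEE : ε ^ 2 * (E * E) ≤ ε ^ 2 * E * (1 / 10 ^ 12) := by
      rw [← mul_assoc]; exact mul_le_mul_of_nonneg_left (he.trans hK100) hε2E.le
    have hρ'' : ρ ≤ ε ^ 2 * E * (1 / 10 ^ 12) := hρ'.trans (mul_le_mul_of_nonneg_left hK100 hε2E.le)
    have h0' : |Y 2 0 0| ≤ 1 / 10 ^ 5 * (ε ^ 2 * E) := by rw [hE]; linarith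
    linarith
  calc |Y 2 0 t| ≤ Real.exp (∫ s in (0:ℝ)..t, |β s|) * (|Y 2 0 0| + ∫ s in (0:ℝ)..t, R s) := hmain
    _ ≤ Real.exp (L * t) * (1 / 10 ^ 4 * ε ^ 2 * Real.exp (-K ^ 10 / 2)) := by
        apply mul_le_mul hexpL hsum ?_ (Real.exp_pos _).le
        have : 0 ≤ ∫ s in (0:ℝ)..t, R s :=
          intervalIntegral.integral_nonneg ht.1 fun s hs' => hR0 s ⟨hs'.1, hs'.2.trans ht.2⟩
        positivity
    _ = 1 / 10 ^ 4 * ε ^ 2 * Real.exp (K ^ 10 * (t * (1 / 10 ^ 5 + t + (K ^ 7)⁻¹)) - K ^ 10 / 2) := by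
        rw [sub_eq_add_neg, Real.exp_add]
        simp only [hL]
        ring_nf

/-! ## The critical time `t_c` of §6.7 -/

/-- `|c₀(0)| ≤ K⁻¹⁰ ε²`. [cite: Tao2016AveragedNS, §6.7 (the time t_c)] -/
theorem Setting.smallC_zero (hs : Setting ε₀ K ε C₁ C₂ C₃ C₄ C₅ n₀ N ηp βp τ Y W F T ζ) : SmallC K ε Y 0 := by
  unfold SmallC
  have hc := hs.hyp.c_abs_le
  have hK := hs.K_pos
  have he : Real.exp (-K ^ 10 / 2) ≤ (K ^ 100)⁻¹ := hs.exp_half_le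
  have h100 : (K ^ 100)⁻¹ ≤ (K ^ 10)⁻¹ := hs.inv_pow_anti (by norm_num)
  have hek : Real.exp (-K ^ 10 / 2) ≤ (K ^ 10)⁻¹ := he.trans h100
  calc |Y 2 0 0| ≤ 1 / 10 ^ 5 * Real.exp (-K ^ 10 / 2) * ε ^ 2 := hc
    _ ≤ 1 * (K ^ 10)⁻¹ * ε ^ 2 := by gcongr; norm_num
    _ = _ := by ring

/-- `t_c ∈ [0, T]`. [cite: Tao2016AveragedNS, §6.7 (the time t_c)] -/
theorem Setting.tc_mem (hs : Setting ε₀ K ε C₁ C₂ C₃ C₄ C₅ n₀ N ηp βp τ Y W F T ζ) :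
    tc K ε Y T ∈ Icc 0 T :=
  ODE.maximalTimeP_mem hs.T_nn hs.smallC_zero

/-- `|c₀(t)| ≤ K⁻¹⁰ ε²` on `[0, t_c]`. [cite: Tao2016AveragedNS, §6.7 (the time t_c)] -/
theorem Setting.smallC_of_mem_tc (hs : Setting ε₀ K ε C₁ C₂ C₃ C₄ C₅ n₀ N ηp βp τ Y W F T ζ) {t : ℝ}
    (ht : t ∈ Icc 0 (tc K ε Y T)) : SmallC K ε Y t := by
  refine ODE.maximalTimeP_spec hs.T_nn hs.smallC_zero (fun s hs' hP => ?_) ht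
  exact le_of_Ico_of_continuousOn (F := fun u => |Y 2 0 u|) hs'.1
    ((hs.continuousOn_Y 2 0 hs.τ₀_le).abs) hP

/-- For `t ≤ 1/2` in `[0, T]`, (6.148) gives `|c₀(t)| ≤ K⁻¹⁰ ε²`.
[cite: Tao2016AveragedNS, §6.7 (the time t_c)] -/
theorem Setting.smallC_of_le_half (hs : Setting ε₀ K ε C₁ C₂ C₃ C₄ C₅ n₀ N ηp βp τ Y W F T ζ) {t : ℝ}
    (ht : t ∈ Icc 0 T) (ht2 : t ≤ 1 / 2) : SmallC K ε Y t := by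
  unfold SmallC
  have h := hs.abs_c_zero_le ht
  have hK := hs.K_pos
  have hK7 : (K ^ 7)⁻¹ ≤ 1 / 2 := hs.inv_K_pow_le_half (by norm_num)
  have hK70 : 0 < (K ^ 7)⁻¹ := by positivity
  have hexp : Real.exp (K ^ 10 * (t * (1 / 10 ^ 5 + t + (K ^ 7)⁻¹)) - K ^ 10 / 2) ≤ (K ^ 10)⁻¹ := by
    have h1 : K ^ 10 * (t * (1 / 10 ^ 5 + t + (K ^ 7)⁻¹)) - K ^ 10 / 2 ≤ -(10 * K) := by
      have ht0 := ht.1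
      have h2 : t * (1 / 10 ^ 5 + t + (K ^ 7)⁻¹) ≤ 1 / 2 * (1 / 10 ^ 5 + 1 / 2 + 1 / 10 ^ 5) := by
        have : (K ^ 7)⁻¹ ≤ 1 / 10 ^ 5 := by
          have := hs.inv_pow_succ_le 6
          have h6 : (K ^ 6)⁻¹ ≤ 1 := by
            have := hs.inv_pow_anti (n := 0) (m := 6) (by norm_num); simpa using this
          linarith
        apply mul_le_mul ht2 (by linarith) (by positivity) (by norm_num)
      have hK6 := hs.K_large
      have hK2 : K ^ 2 ≤ K ^ 10 := pow_le_pow_right₀ hs.one_le_K (by norm_num)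
      nlinarith
    calc Real.exp (K ^ 10 * (t * (1 / 10 ^ 5 + t + (K ^ 7)⁻¹)) - K ^ 10 / 2)
        ≤ Real.exp (-(10 * K)) := Real.exp_le_exp.2 h1
      _ ≤ (K ^ 10)⁻¹ := by
          rw [Real.exp_neg]
          apply inv_anti₀ (pow_pos hK 10)
          have := pow_le_exp_mul hK.le 10
          simpa using this
  have hε2 : 0 ≤ ε ^ 2 := sq_nonneg ε
  calc |Y 2 0 t| ≤ 1 / 10 ^ 4 * ε ^ 2 *
        Real.exp (K ^ 10 * (t * (1 / 10 ^ 5 + t + (K ^ 7)⁻¹)) - K ^ 10 / 2) := h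
    _ ≤ 1 * ε ^ 2 * (K ^ 10)⁻¹ := by gcongr; norm_num
    _ = _ := by ring

/-- `t_c ≥ min(T, 1/2)` (the source's "`t_c ≥ 1/2`"). [cite: Tao2016AveragedNS, §6.7 (the time t_c)] -/
theorem Setting.min_le_tc (hs : Setting ε₀ K ε C₁ C₂ C₃ C₄ C₅ n₀ N ηp βp τ Y W F T ζ) :
    min T (1 / 2) ≤ tc K ε Y T :=
  ODE.le_maximalTimeP ⟨le_min hs.T_nn (by norm_num), min_le_left _ _⟩ fun t ht =>
    hs.smallC_of_le_half ⟨ht.1, ht.2.trans (min_le_left _ _)⟩ (ht.2.trans (min_le_right _ _))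

/-- **(t_c)**: while `|c₀| ≤ K⁻¹⁰ ε²` (on `[0, t⋆]`, `t⋆ ≤ T`), the modes `d₀, a₁` stay small:
`√(d₀² + a₁²) ≤ 700 K⁻¹⁰` (from (6.132)–(6.133): the `K d₀ a₁` terms cancel in `d₀∂d₀ + a₁∂a₁`).
[cite: Tao2016AveragedNS, §6.7 (6.149)–(6.150)] -/
theorem Setting.sqrt_da_le (hs : Setting ε₀ K ε C₁ C₂ C₃ C₄ C₅ n₀ N ηp βp τ Y W F T ζ) {T' : ℝ}
    (hT' : T' ∈ Icc 0 T) (hP : ∀ s ∈ Icc 0 T', SmallC K ε Y s) {t : ℝ} (ht : t ∈ Icc 0 T') :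
    Real.sqrt (Y 3 0 t ^ 2 + Y 0 1 t ^ 2) ≤ 700 * (K ^ 10)⁻¹ := by
  have hK := hs.K_pos
  have hε := hs.ε_pos
  have hε1 := hs.ε_le_one hε
  have hεK := hs.ε_le_K100
  have hρ := hs.ρ_le_ε
  have hτ₀ := hs.τ₀_le
  have hK10 : 0 < (K ^ 10)⁻¹ := by positivity
  set ρ := C₁ * (1 + ε₀) ^ (-(n₀ : ℝ) / 2) with hρdef
  have hρ0 : 0 ≤ ρ := mul_nonneg hs.C₁_nn (Real.rpow_nonneg hs.q_pos.le _)
  set M : ℝ := 2 * (K ^ 10)⁻¹ with hM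
  set L : ℝ := 16 * C₄ * ε ^ 2 with hL
  have hL0 : 0 ≤ L := by have := hs.C₄_nn; positivity
  -- smallness of the constant terms
  have hE : ρ + 4 * C₄ * Real.exp (-K ^ 10 / 2) * (K ^ 10)⁻¹ + 4 * ρ ≤ 1 / 2 * (K ^ 10)⁻¹ := by
    have h1 : ρ ≤ (K ^ 100)⁻¹ := hρ.trans hεK
    have h2 : (K ^ 100)⁻¹ ≤ 1 / 10 ^ 6 * (K ^ 10)⁻¹ :=
      (hs.inv_pow_anti (by norm_num : 11 ≤ 100)).trans (hs.inv_pow_succ_le 10)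
    have h3 : C₄ * Real.exp (-K ^ 10 / 2) ≤ 1 / 10 ^ 6 := by
      calc C₄ * Real.exp (-K ^ 10 / 2) ≤ K * (K ^ 100)⁻¹ :=
            mul_le_mul hs.C₄_le hs.exp_half_le (Real.exp_pos _).le hK.le
        _ ≤ (K ^ 99)⁻¹ := hs.mul_inv_pow_succ_le le_rfl 99
        _ ≤ 1 / 10 ^ 6 * (K ^ 98)⁻¹ := hs.inv_pow_succ_le 98
        _ ≤ 1 / 10 ^ 6 * 1 := by
            gcongr; have := hs.inv_pow_anti (n := 0) (m := 98) (by norm_num); simpa using this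
        _ = _ := mul_one _
    nlinarith
  have hbound : ∀ x ∈ Ico 0 T',
      Y 3 0 x * dY (τ (n₀ - N)) Y 3 0 x + Y 0 1 x * dY (τ (n₀ - N)) Y 0 1 x ≤
        M * Real.sqrt (Y 3 0 x ^ 2 + Y 0 1 x ^ 2) + L * (Y 3 0 x ^ 2 + Y 0 1 x ^ 2) := by
    intro x hx
    have hxT : x ∈ Icc 0 T := ⟨hx.1, hx.2.le.trans hT'.2⟩
    have hrd := hs.dd_zero hxT
    have hr1' := hs.da_one hxT
    have hc := hP x (Ico_subset_Icc_self hx)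
    unfold SmallC at hc
    have ha := hs.abs_Y_zero_le 0 hxT
    set a := Y 0 0 x; set c := Y 2 0 x; set d := Y 3 0 x; set a₁ := Y 0 1 x
    set Dd := dY (τ (n₀ - N)) Y 3 0 x; set D1 := dY (τ (n₀ - N)) Y 0 1 x
    set q52 := (1 + ε₀) ^ ((5 : ℝ) / 2)
    set rd := Dd - ((ε ^ 2)⁻¹ * c * a - q52 * K * d * a₁)
    set r1 := D1 - q52 * K * d ^ 2
    set B := 4 * C₄ * Real.exp (-K ^ 10 / 2) * (K ^ 10)⁻¹ + 4 * ρ with hB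
    have hr1 : |r1| ≤ 16 * C₄ * ε ^ 2 * |a₁| + B := by
      simp only [hB, hρdef]; linarith [hr1']
    have key : d * Dd + a₁ * D1 = (ε ^ 2)⁻¹ * c * a * d + d * rd + a₁ * r1 := by
      simp only [rd, r1]; ring
    rw [key]
    set r := Real.sqrt (d ^ 2 + a₁ ^ 2)
    have hdr : |d| ≤ r := Real.abs_le_sqrt (by nlinarith)
    have ha1r : |a₁| ≤ r := Real.abs_le_sqrt (by nlinarith)
    have hr0 : 0 ≤ r := Real.sqrt_nonneg _
    have hr2 : r ^ 2 = d ^ 2 + a₁ ^ 2 := Real.sq_sqrt (by positivity)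
    -- first term
    have e1 : (ε ^ 2)⁻¹ * c * a * d ≤ r * (3 / 2 * (K ^ 10)⁻¹) := by
      calc (ε ^ 2)⁻¹ * c * a * d ≤ |(ε ^ 2)⁻¹ * c * a * d| := le_abs_self _
        _ = (ε ^ 2)⁻¹ * |c| * |a| * |d| := by
            rw [abs_mul, abs_mul, abs_mul, abs_of_pos (by positivity : (0:ℝ) < (ε ^ 2)⁻¹)]
        _ ≤ (ε ^ 2)⁻¹ * ((K ^ 10)⁻¹ * ε ^ 2) * (3 / 2) * r := by gcongr
        _ = r * (3 / 2 * (K ^ 10)⁻¹) := by field_simp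
    have e2 : d * rd ≤ r * ρ := by
      calc d * rd ≤ |d * rd| := le_abs_self _
        _ = |d| * |rd| := abs_mul _ _
        _ ≤ r * ρ := mul_le_mul hdr hrd (abs_nonneg _) hr0
    have e3 : a₁ * r1 ≤ r * (16 * C₄ * ε ^ 2 * r + B) := by
      calc a₁ * r1 ≤ |a₁ * r1| := le_abs_self _
        _ = |a₁| * |r1| := abs_mul _ _
        _ ≤ r * (16 * C₄ * ε ^ 2 * |a₁| + B) := mul_le_mul ha1r hr1 (abs_nonneg _) hr0
        _ ≤ _ := by have := hs.C₄_nn; gcongr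
    have hcoef : 3 / 2 * (K ^ 10)⁻¹ + ρ + B ≤ M := by simp only [hM, hB]; linarith
    calc (ε ^ 2)⁻¹ * c * a * d + d * rd + a₁ * r1
        ≤ r * (3 / 2 * (K ^ 10)⁻¹) + r * ρ + r * (16 * C₄ * ε ^ 2 * r + B) :=
          add_le_add (add_le_add e1 e2) e3
      _ = (3 / 2 * (K ^ 10)⁻¹ + ρ + B) * r + L * r ^ 2 := by simp only [hL]; ring
      _ ≤ M * r + L * r ^ 2 := by gcongr
      _ = M * r + L * (d ^ 2 + a₁ ^ 2) := by rw [hr2]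
  have hmain := sqrt_sq_add_sq_le_of_deriv (hs.continuousOn_Y 3 0 (b := T') hτ₀)
    (hs.continuousOn_Y 0 1 (b := T') hτ₀)
    (fun x hx => hs.hasDerivWithinAt_Y 3 0 (hτ₀.trans hx.1))
    (fun x hx => hs.hasDerivWithinAt_Y 0 1 (hτ₀.trans hx.1)) (by positivity) hL0 hbound ht
  rw [sub_zero] at hmain
  -- initial value
  have hinit : Real.sqrt (Y 3 0 0 ^ 2 + Y 0 1 0 ^ 2) ≤ 2 * (K ^ 10)⁻¹ := by
    have hd := hs.hyp.d_abs_le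
    have ha1 : |Y 0 1 0| ≤ (K ^ 10)⁻¹ := by
      have h1 := hs.sq_Y_le 0 1 hτ₀
      have h2 := hs.F_one_zero_le
      have h3 : (K ^ 30)⁻¹ ≤ 1 / 10 ^ 6 * (K ^ 20)⁻¹ :=
        (hs.inv_pow_anti (by norm_num : 21 ≤ 30)).trans (hs.inv_pow_succ_le 20)
      have h4 : (K ^ 10)⁻¹ ^ 2 = (K ^ 20)⁻¹ := by rw [← inv_pow, ← pow_mul, inv_pow]
      have h5 : (0:ℝ) ≤ (K ^ 20)⁻¹ := by positivity
      have hsq : Y 0 1 0 ^ 2 ≤ ((K ^ 10)⁻¹) ^ 2 := by rw [h4]; linarith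
      calc |Y 0 1 0| = Real.sqrt (Y 0 1 0 ^ 2) := (Real.sqrt_sq_eq_abs _).symm
        _ ≤ Real.sqrt (((K ^ 10)⁻¹) ^ 2) := Real.sqrt_le_sqrt hsq
        _ = (K ^ 10)⁻¹ := Real.sqrt_sq hK10.le
    rw [Real.sqrt_le_iff]
    refine ⟨by positivity, ?_⟩
    calc Y 3 0 0 ^ 2 + Y 0 1 0 ^ 2 = |Y 3 0 0| ^ 2 + |Y 0 1 0| ^ 2 := by rw [sq_abs, sq_abs]
      _ ≤ (|Y 3 0 0| + |Y 0 1 0|) ^ 2 := by nlinarith [abs_nonneg (Y 3 0 0), abs_nonneg (Y 0 1 0)]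
      _ ≤ (2 * (K ^ 10)⁻¹) ^ 2 := by
          apply pow_le_pow_left₀ (by positivity); linarith
  -- the exponential factor
  have ht100 : t ≤ 100 := ht.2.trans (hT'.2.trans hs.T_le)
  have hexp : Real.exp (L * t) ≤ 3 := by
    have hLt : L * t ≤ 1 := by
      have hC₄ := hs.C₄_le
      have hC₄0 := hs.C₄_nn
      have : L ≤ 16 * K * (K ^ 100)⁻¹ * ε := by
        simp only [hL]; rw [pow_two]
        calc 16 * C₄ * (ε * ε) ≤ 16 * K * ((K ^ 100)⁻¹ * ε) := by gcongr
          _ = _ := by ring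
      have h2 : K * (K ^ 100)⁻¹ ≤ (K ^ 99)⁻¹ := hs.mul_inv_pow_succ_le le_rfl 99
      have h3 : (K ^ 99)⁻¹ ≤ 1 / 10 ^ 6 * (K ^ 98)⁻¹ := hs.inv_pow_succ_le 98
      have h4 : (K ^ 98)⁻¹ ≤ 1 := by
        have := hs.inv_pow_anti (n := 0) (m := 98) (by norm_num); simpa using this
      have ht0 := ht.1
      nlinarith
    calc Real.exp (L * t) ≤ Real.exp 1 := Real.exp_le_exp.2 hLt
      _ ≤ 3 := exp_one_le_three
  have ht0 := ht.1
  have hM0 : 0 ≤ M := by positivity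
  calc Real.sqrt (Y 3 0 t ^ 2 + Y 0 1 t ^ 2)
      ≤ Real.exp (L * t) * (Real.sqrt (Y 3 0 0 ^ 2 + Y 0 1 0 ^ 2) + M * t) := hmain
    _ ≤ 3 * (2 * (K ^ 10)⁻¹ + M * 100) := by gcongr
    _ ≤ 700 * (K ^ 10)⁻¹ := by simp only [hM]; nlinarith

/-! ## The interval `[0, t_c]`: `a₀ ≈ 1`, `b₀` affine, `Ẽ₋₁` frozen, `c₀` ignites -/

/-- While `|c₀| ≤ K⁻¹⁰ ε²` (on `[0, T']`): `a₀² ≥ 1 - 2K⁻⁸` (from (6.146), (6.147) and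
`Setting.sqrt_da_le`). [cite: Tao2016AveragedNS, §6.7 (the display `a₀(t) = 1 + O(K⁻⁹)`)] -/
theorem Setting.sq_a_zero_ge (hs : Setting ε₀ K ε C₁ C₂ C₃ C₄ C₅ n₀ N ηp βp τ Y W F T ζ) {T' : ℝ}
    (hT' : T' ∈ Icc 0 T) (hP : ∀ s ∈ Icc 0 T', SmallC K ε Y s) {t : ℝ} (ht : t ∈ Icc 0 T') :
    1 - 2 * (K ^ 8)⁻¹ ≤ Y 0 0 t ^ 2 := by
  have htT : t ∈ Icc 0 T := ⟨ht.1, ht.2.trans hT'.2⟩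
  have hS := hs.sumSq_bound htT
  have hbc := hs.sqrt_bc_le htT
  have hda := hs.sqrt_da_le hT' hP ht
  have hK := hs.K_pos
  have hε := hs.ε_pos
  have hεK := hs.ε_le_K100
  have hK8 : 0 < (K ^ 8)⁻¹ := by positivity
  have ht100 : t ≤ 100 := htT.2.trans hs.T_le
  -- squares of the two pairs
  have h1 : Y 1 0 t ^ 2 + Y 2 0 t ^ 2 ≤ ((1 / 10 ^ 5 + t + (K ^ 7)⁻¹) * ε) ^ 2 := by
    have h0 : 0 ≤ Y 1 0 t ^ 2 + Y 2 0 t ^ 2 := by positivity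
    have := pow_le_pow_left₀ (Real.sqrt_nonneg _) hbc 2
    rwa [Real.sq_sqrt h0] at this
  have h2 : Y 3 0 t ^ 2 + Y 0 1 t ^ 2 ≤ (700 * (K ^ 10)⁻¹) ^ 2 := by
    have h0 : 0 ≤ Y 3 0 t ^ 2 + Y 0 1 t ^ 2 := by positivity
    have := pow_le_pow_left₀ (Real.sqrt_nonneg _) hda 2
    rwa [Real.sq_sqrt h0] at this
  -- both are ≤ ½ K⁻⁸
  have hK7 : (K ^ 7)⁻¹ ≤ 1 := by
    have := hs.inv_pow_anti (n := 0) (m := 7) (by norm_num); simpa using this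
  have h1' : ((1 / 10 ^ 5 + t + (K ^ 7)⁻¹) * ε) ^ 2 ≤ 1 / 2 * (K ^ 8)⁻¹ := by
    have hc : (1 / 10 ^ 5 + t + (K ^ 7)⁻¹) * ε ≤ 102 * ε := by
      have : 1 / 10 ^ 5 + t + (K ^ 7)⁻¹ ≤ 102 := by linarith
      exact mul_le_mul_of_nonneg_right this hε.le
    have hc0 : 0 ≤ (1 / 10 ^ 5 + t + (K ^ 7)⁻¹) * ε := by
      have := ht.1; positivity
    have h102 : (102 * ε) ^ 2 ≤ 1 / 2 * (K ^ 8)⁻¹ := by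
      have hε1 := hs.ε_le_one hε
      have h100_8 : (K ^ 100)⁻¹ ≤ 1 / 10 ^ 6 * (K ^ 8)⁻¹ :=
        (hs.inv_pow_anti (by norm_num : 9 ≤ 100)).trans (hs.inv_pow_succ_le 8)
      nlinarith
    exact (pow_le_pow_left₀ hc0 hc 2).trans h102
  have h2' : (700 * (K ^ 10)⁻¹) ^ 2 ≤ 1 / 2 * (K ^ 8)⁻¹ := by
    have h10 : (K ^ 10)⁻¹ ≤ 1 / 10 ^ 6 * (K ^ 9)⁻¹ := hs.inv_pow_succ_le 9
    have h9 : (K ^ 9)⁻¹ ≤ 1 / 10 ^ 6 * (K ^ 8)⁻¹ := hs.inv_pow_succ_le 8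
    have h9' : (K ^ 9)⁻¹ ≤ 1 := by
      have := hs.inv_pow_anti (n := 0) (m := 9) (by norm_num); simpa using this
    have hK10 : 0 ≤ (K ^ 10)⁻¹ := by positivity
    nlinarith
  rw [abs_le] at hS
  unfold sumSq at hS
  nlinarith

/-- While `|c₀| ≤ K⁻¹⁰ ε²` (on `[0, T']`): `1 - 2K⁻⁸ ≤ a₀(t) ≤ 1 + K⁻⁸` (the display
`a₀(t) = 1 + O(K⁻⁹)` of §6.7; positivity of `a₀` by continuity from `a₀(0) = 1`).
[cite: Tao2016AveragedNS, §6.7 (the display `a₀(t) = 1 + O(K⁻⁹)`)] -/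
theorem Setting.a_zero_bounds (hs : Setting ε₀ K ε C₁ C₂ C₃ C₄ C₅ n₀ N ηp βp τ Y W F T ζ) {T' : ℝ}
    (hT' : T' ∈ Icc 0 T) (hP : ∀ s ∈ Icc 0 T', SmallC K ε Y s) {t : ℝ} (ht : t ∈ Icc 0 T') :
    1 - 2 * (K ^ 8)⁻¹ ≤ Y 0 0 t ∧ Y 0 0 t ≤ 1 + (K ^ 8)⁻¹ := by
  have hK := hs.K_pos
  have hK8 : 0 < (K ^ 8)⁻¹ := by positivity
  have hK8' : (K ^ 8)⁻¹ ≤ 1 / 2 := hs.inv_K_pow_le_half (by norm_num)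
  have hsq := hs.sq_a_zero_ge hT' hP ht
  -- positivity of `a₀` on `[0, t]`
  have hpos : 0 < Y 0 0 t := by
    by_contra hle
    push Not at hle
    have hcont : ContinuousOn (Y 0 0) (Icc 0 t) := hs.continuousOn_Y 0 0 hs.τ₀_le
    have h0 : Y 0 0 0 = 1 := hs.hyp.a_eq
    obtain ⟨s, hsI, hs0⟩ := intermediate_value_Icc' ht.1 hcont ⟨hle, by rw [h0]; norm_num⟩
    have hsq' := hs.sq_a_zero_ge hT' hP ⟨hsI.1, hsI.2.trans ht.2⟩
    rw [hs0] at hsq'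
    norm_num at hsq'
    have : (K ^ 8)⁻¹ ≤ 1 / 10 ^ 6 * (K ^ 7)⁻¹ := hs.inv_pow_succ_le 7
    have h7 : (K ^ 7)⁻¹ ≤ 1 := by
      have := hs.inv_pow_anti (n := 0) (m := 7) (by norm_num); simpa using this
    linarith
  constructor
  · -- `a₀ ≥ √(1 - 2K⁻⁸) ≥ 1 - 2K⁻⁸`
    have hy0 : 0 ≤ 1 - 2 * (K ^ 8)⁻¹ := by linarith
    have hy1 : 1 - 2 * (K ^ 8)⁻¹ ≤ 1 := by linarith
    calc 1 - 2 * (K ^ 8)⁻¹ ≤ Real.sqrt (1 - 2 * (K ^ 8)⁻¹) := by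
          rw [Real.le_sqrt hy0 hy0]; nlinarith
      _ ≤ Real.sqrt (Y 0 0 t ^ 2) := Real.sqrt_le_sqrt hsq
      _ = Y 0 0 t := by rw [Real.sqrt_sq hpos.le]
  · have hup := hs.sq_a_zero_le ⟨ht.1, ht.2.trans hT'.2⟩
    nlinarith

/-- While `|c₀| ≤ K⁻¹⁰ ε²` (on `[0, T']`): the lower affine bound (6.157)
`b₀(t) ≥ -10⁻⁵ ε + ε (1 - 5K⁻⁸) t` (from (6.130) and `a₀² ≥ 1 - 4K⁻⁸`).
[cite: Tao2016AveragedNS, §6.7 (6.157)] -/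
theorem Setting.b_zero_ge (hs : Setting ε₀ K ε C₁ C₂ C₃ C₄ C₅ n₀ N ηp βp τ Y W F T ζ) {T' : ℝ}
    (hT' : T' ∈ Icc 0 T) (hP : ∀ s ∈ Icc 0 T', SmallC K ε Y s) {t : ℝ} (ht : t ∈ Icc 0 T') :
    -(1 / 10 ^ 5 * ε) + ε * (1 - 5 * (K ^ 8)⁻¹) * t ≤ Y 1 0 t := by
  have hK := hs.K_pos
  have hε := hs.ε_pos
  have hτ₀ := hs.τ₀_le
  have hbound : ∀ x ∈ Ico 0 T', ε * (1 - 5 * (K ^ 8)⁻¹) ≤ dY (τ (n₀ - N)) Y 1 0 x := by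
    intro x hx
    have hxT' : x ∈ Icc 0 T' := Ico_subset_Icc_self hx
    have hxT : x ∈ Icc 0 T := ⟨hx.1, hx.2.le.trans hT'.2⟩
    have hrb := hs.db_zero hxT
    have ha := hs.sq_a_zero_ge hT' hP hxT'
    have hc := hP x hxT'
    unfold SmallC at hc
    have hρ := hs.ρ_le_ε
    have hεK := hs.ε_le_K100
    have hK10 : 0 < (K ^ 10)⁻¹ := by positivity
    have hK8 : 0 < (K ^ 8)⁻¹ := by positivity
    -- `ε⁻¹ K¹⁰ c₀² ≤ K⁻¹⁰ ε³ ≤ ε K⁻⁸ · 10⁻⁶`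
    have hc2 : ε⁻¹ * K ^ 10 * Y 2 0 x ^ 2 ≤ (K ^ 10)⁻¹ * ε ^ 3 := by
      have h1 : Y 2 0 x ^ 2 ≤ ((K ^ 10)⁻¹ * ε ^ 2) ^ 2 := by
        have := pow_le_pow_left₀ (abs_nonneg _) hc 2; rwa [sq_abs] at this
      calc ε⁻¹ * K ^ 10 * Y 2 0 x ^ 2 ≤ ε⁻¹ * K ^ 10 * ((K ^ 10)⁻¹ * ε ^ 2) ^ 2 := by gcongr
        _ = (K ^ 10)⁻¹ * ε ^ 3 := by field_simp
    have hsmall : (K ^ 10)⁻¹ * ε ^ 3 + C₁ * (1 + ε₀) ^ (-(n₀ : ℝ) / 2) ≤ ε * (K ^ 8)⁻¹ := by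
      have hε1 := hs.ε_le_one hε
      have h100_8 : (K ^ 100)⁻¹ ≤ 1 / 10 ^ 6 * (K ^ 8)⁻¹ :=
        (hs.inv_pow_anti (by norm_num : 9 ≤ 100)).trans (hs.inv_pow_succ_le 8)
      have h10_8 : (K ^ 10)⁻¹ ≤ (K ^ 8)⁻¹ := hs.inv_pow_anti (by norm_num)
      have hρ4 := hs.ρ_le
      have e0 : ε ^ 4 * Real.exp (-10 * K ^ 10) ≤ ε * ε := by
        have he : Real.exp (-10 * K ^ 10) ≤ 1 := by
          rw [Real.exp_le_one_iff]; have := pow_nonneg hK.le 10; linarith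
        calc ε ^ 4 * Real.exp (-10 * K ^ 10) ≤ ε ^ 4 * 1 := by gcongr
          _ = ε * ε * (ε * ε) := by ring
          _ ≤ ε * ε * (1 * 1) := by gcongr
          _ = ε * ε := by ring
      have e1 : (K ^ 10)⁻¹ * ε ^ 3 ≤ ε * (K ^ 8)⁻¹ * (1 / 4) := by
        have hε2 : ε ^ 2 ≤ 1 / 4 := by
          have h8 : (K ^ 8)⁻¹ ≤ 1 := by
            have := hs.inv_pow_anti (n := 0) (m := 8) (by norm_num); simpa using this
          have : ε ≤ 1 / 2 := by linarith
          nlinarith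
        calc (K ^ 10)⁻¹ * ε ^ 3 = ε * (K ^ 10)⁻¹ * ε ^ 2 := by ring
          _ ≤ ε * (K ^ 8)⁻¹ * (1 / 4) := by gcongr
      have e2 : C₁ * (1 + ε₀) ^ (-(n₀ : ℝ) / 2) ≤ ε * (K ^ 8)⁻¹ * (1 / 10 ^ 6) := by
        calc C₁ * (1 + ε₀) ^ (-(n₀ : ℝ) / 2) ≤ ε * ε := hρ4.trans e0
          _ ≤ ε * (K ^ 100)⁻¹ := by gcongr
          _ ≤ ε * (1 / 10 ^ 6 * (K ^ 8)⁻¹) := by gcongr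
          _ = ε * (K ^ 8)⁻¹ * (1 / 10 ^ 6) := by ring
      have hP0 : 0 ≤ ε * (K ^ 8)⁻¹ := by positivity
      linarith
    rw [abs_le] at hrb
    nlinarith
  have h := add_mul_le_of_le_deriv (hs.continuousOn_Y 1 0 (b := T') hτ₀)
    (fun x hx => hs.hasDerivWithinAt_Y 1 0 (hτ₀.trans hx.1)) hbound ht
  have hb0 := hs.hyp.b_abs_le
  rw [abs_le] at hb0
  rw [sub_zero] at h
  linarith [hb0.1]

/-- While `|c₀| ≤ K⁻¹⁰ ε²` (on `[0, T']`): `Ẽ₋₁` barely moves,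
`Ẽ₋₁(t) ≤ K⁻²⁰ + 8K⁻¹⁴ t` (from (6.49) at `k = -1`, `a₀ ≥ 0`, and (6.92) at `m = 2, 3`; the
source's "`∂ₜẼ₋₁ ≤ O(K⁻¹⁴)` … which rules out the first option of Corollary 6.14").
[cite: Tao2016AveragedNS, §6.7 (before (6.154))] -/
theorem Setting.F_negOne_le_tc (hs : Setting ε₀ K ε C₁ C₂ C₃ C₄ C₅ n₀ N ηp βp τ Y W F T ζ) {T' : ℝ}
    (hT' : T' ∈ Icc 0 T) (hP : ∀ s ∈ Icc 0 T', SmallC K ε Y s) {t : ℝ} (ht : t ∈ Icc 0 T') :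
    F (-1) t ≤ (K ^ 20)⁻¹ + 8 * (K ^ 14)⁻¹ * t := by
  have hK := hs.K_pos
  have hτ₀ := hs.τ₀_le
  have hbound : ∀ x ∈ Ico 0 T', dF (τ (n₀ - N)) F (-1) x ≤ 8 * (K ^ 14)⁻¹ := by
    intro x hx
    have hxT' : x ∈ Icc 0 T' := Ico_subset_Icc_self hx
    have hxT : x ∈ Icc 0 T := ⟨hx.1, hx.2.le.trans hT'.2⟩
    have h := hs.dF_negOne hxT
    have ha0 := (hs.a_zero_bounds hT' hP hxT').1
    have hK8 : (K ^ 8)⁻¹ ≤ 1 / 2 := hs.inv_K_pow_le_half (by norm_num)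
    have ha0' : 0 ≤ Y 0 0 x := by linarith
    have hd2 := hs.absP_negTwo_le hxT
    have ha1 := hs.abs_Y_negOne_le 0 hxT
    have hq := hs.qm52_le
    have hq0 : 0 ≤ (1 + ε₀) ^ (-(5 : ℝ) / 2) := Real.rpow_nonneg hs.q_pos.le _
    have hq5 : 0 ≤ (1 + ε₀) ^ ((5 : ℝ) / 2) := Real.rpow_nonneg hs.q_pos.le _
    have hneg : K * Y 3 (-1) x ^ 2 * Y 0 0 x ≥ 0 := by positivity
    have hpos : (Y 3 (-2) x ^ 2 - W 2 (-2) x ^ 2) * Y 0 (-1) x ≤ 4 * (K ^ 10)⁻¹ * (2 * (K ^ 5)⁻¹) := by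
      calc (Y 3 (-2) x ^ 2 - W 2 (-2) x ^ 2) * Y 0 (-1) x
          ≤ |Y 3 (-2) x ^ 2 - W 2 (-2) x ^ 2| * |Y 0 (-1) x| := by
            rw [← abs_mul]; exact le_abs_self _
        _ ≤ 4 * (K ^ 10)⁻¹ * (2 * (K ^ 5)⁻¹) :=
            mul_le_mul hd2 ha1 (abs_nonneg _) (by positivity)
    -- slack: `(1+ε₀)^{-5/2} ≤ (1+ε₀)^{-1} ≤ 1 - ε₀/4` absorbs the asymmetry budget `C₁(1+ε₀)^{-n₀/2} ≤ ε`
    have hq1 : (1 + ε₀) ^ (-(5 : ℝ) / 2) ≤ 1 - ε₀ / 4 := by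
      have h1 := rpow_neg_le_one_sub hs.ε₀_pos hs.ε₀_lt.le (p := 1) one_pos le_rfl
      calc (1 + ε₀) ^ (-(5 : ℝ) / 2) ≤ (1 + ε₀) ^ (-(1 : ℝ)) :=
            Real.rpow_le_rpow_of_exponent_le hs.one_lt_q.le (by norm_num)
        _ ≤ 1 - 1 * ε₀ / 4 := h1
        _ = 1 - ε₀ / 4 := by ring
    have hρ := hs.ρ_le_ε
    have hεK := hs.ε_le_K100
    have hKε₀ := hs.Kε₀
    have hK1 := hs.one_le_K
    have hslack : C₁ * (1 + ε₀) ^ (-(n₀ : ℝ) / 2) ≤ 8 * (K ^ 14)⁻¹ * (ε₀ / 4) := by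
      -- `ε ≤ K⁻¹⁰⁰ ≤ 2 ε₀ K⁻¹⁴` since `K ε₀ ≥ 10⁶`
      have h100 : (K ^ 100)⁻¹ ≤ (K ^ 15)⁻¹ := by
        apply inv_anti₀ (by positivity); exact pow_le_pow_right₀ hK1 (by norm_num)
      have h15 : (K ^ 15)⁻¹ = (K ^ 14)⁻¹ * K⁻¹ := by rw [← mul_inv, ← pow_succ]
      have hKinv : K⁻¹ ≤ ε₀ / 10 ^ 6 := by
        rw [inv_le_iff_one_le_mul₀ hK]
        nlinarith
      have hK14 : 0 ≤ (K ^ 14)⁻¹ := by positivity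
      calc C₁ * (1 + ε₀) ^ (-(n₀ : ℝ) / 2) ≤ ε := hρ
        _ ≤ (K ^ 100)⁻¹ := hεK
        _ ≤ (K ^ 14)⁻¹ * K⁻¹ := by rw [← h15]; exact h100
        _ ≤ (K ^ 14)⁻¹ * (ε₀ / 10 ^ 6) := mul_le_mul_of_nonneg_left hKinv hK14
        _ ≤ 8 * (K ^ 14)⁻¹ * (ε₀ / 4) := by nlinarith [hs.ε₀_pos]
    have hK15 : K * ((1 + ε₀) ^ (-(5 : ℝ) / 2)) * (4 * (K ^ 10)⁻¹ * (2 * (K ^ 5)⁻¹)) +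
        C₁ * (1 + ε₀) ^ (-(n₀ : ℝ) / 2) ≤ 8 * (K ^ 14)⁻¹ := by
      have e : K * (4 * (K ^ 10)⁻¹ * (2 * (K ^ 5)⁻¹)) = 8 * (K ^ 14)⁻¹ := by field_simp; ring
      have h1 : K * ((1 + ε₀) ^ (-(5 : ℝ) / 2)) * (4 * (K ^ 10)⁻¹ * (2 * (K ^ 5)⁻¹)) ≤
          8 * (K ^ 14)⁻¹ * (1 - ε₀ / 4) := by
        calc K * ((1 + ε₀) ^ (-(5 : ℝ) / 2)) * (4 * (K ^ 10)⁻¹ * (2 * (K ^ 5)⁻¹))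
            = (1 + ε₀) ^ (-(5 : ℝ) / 2) * (K * (4 * (K ^ 10)⁻¹ * (2 * (K ^ 5)⁻¹))) := by ring
          _ ≤ (1 - ε₀ / 4) * (8 * (K ^ 14)⁻¹) := by
              rw [e]; exact mul_le_mul_of_nonneg_right hq1 (by positivity)
          _ = _ := by ring
      linarith
    calc dF (τ (n₀ - N)) F (-1) x
        ≤ K * (1 + ε₀) ^ (-(5 : ℝ) / 2) * ((Y 3 (-2) x ^ 2 - W 2 (-2) x ^ 2) * Y 0 (-1) x) -
            K * Y 3 (-1) x ^ 2 * Y 0 0 x + C₁ * (1 + ε₀) ^ (-(n₀ : ℝ) / 2) := h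
      _ ≤ K * (1 + ε₀) ^ (-(5 : ℝ) / 2) * ((Y 3 (-2) x ^ 2 - W 2 (-2) x ^ 2) * Y 0 (-1) x) +
            C₁ * (1 + ε₀) ^ (-(n₀ : ℝ) / 2) := by linarith
      _ ≤ K * (1 + ε₀) ^ (-(5 : ℝ) / 2) * (4 * (K ^ 10)⁻¹ * (2 * (K ^ 5)⁻¹)) +
            C₁ * (1 + ε₀) ^ (-(n₀ : ℝ) / 2) := by
          have := mul_le_mul_of_nonneg_left hpos (by positivity : 0 ≤ K * (1 + ε₀) ^ (-(5 : ℝ) / 2))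
          linarith
      _ ≤ 8 * (K ^ 14)⁻¹ := hK15
  have h := le_add_mul_of_deriv_le (hs.continuousOn_F (-1) (b := T') hτ₀)
    (fun x hx => hs.hasDerivWithinAt_F (-1) (hτ₀.trans hx.1)) hbound ht
  have h0 := hs.hyp.energy_prev_le
  rw [sub_zero] at h
  linarith

/-- While `|c₀| ≤ K⁻¹⁰ ε²` (on `[0, T']`, `T' ≤ T`): `Ẽ₋₁ < K⁻¹⁰ (1+ε₀)^{2/10}` on `[0, T']`, i.e.
the "backwards flow of energy" exit of Cor. 6.14 does not occur before `t_c`.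
[cite: Tao2016AveragedNS, §6.7 (before (6.154))] -/
theorem Setting.F_negOne_lt_exit (hs : Setting ε₀ K ε C₁ C₂ C₃ C₄ C₅ n₀ N ηp βp τ Y W F T ζ) {T' : ℝ}
    (hT' : T' ∈ Icc 0 T) (hP : ∀ s ∈ Icc 0 T', SmallC K ε Y s) {t : ℝ} (ht : t ∈ Icc 0 T') :
    F (-1) t < (K ^ 10)⁻¹ * (1 + ε₀) ^ ((2 : ℝ) / 10) := by
  have h := hs.F_negOne_le_tc hT' hP ht
  have hK := hs.K_pos
  have ht100 : t ≤ 100 := (ht.2.trans hT'.2).trans hs.T_le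
  have h20 : (K ^ 20)⁻¹ ≤ 1 / 10 ^ 6 * (K ^ 10)⁻¹ :=
    (hs.inv_pow_anti (by norm_num : 11 ≤ 20)).trans (hs.inv_pow_succ_le 10)
  have h14 : (K ^ 14)⁻¹ ≤ 1 / 10 ^ 6 * (K ^ 10)⁻¹ :=
    (hs.inv_pow_anti (by norm_num : 11 ≤ 14)).trans (hs.inv_pow_succ_le 10)
  have hK10 : 0 < (K ^ 10)⁻¹ := by positivity
  have hq : 1 ≤ (1 + ε₀) ^ ((2 : ℝ) / 10) := hs.one_le_q_rpow (by norm_num)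
  have hK14 : 0 ≤ (K ^ 14)⁻¹ := by positivity
  calc F (-1) t ≤ (K ^ 20)⁻¹ + 8 * (K ^ 14)⁻¹ * t := h
    _ ≤ (K ^ 20)⁻¹ + 8 * (K ^ 14)⁻¹ * 100 := by gcongr
    _ < (K ^ 10)⁻¹ * 1 := by nlinarith
    _ ≤ (K ^ 10)⁻¹ * (1 + ε₀) ^ ((2 : ℝ) / 10) := by gcongr

/-- **`c₀` ignites** (the display "`c₀(t) ≳ exp((t²/2 - 10⁻⁵t - 1 + O(K⁻⁹))K¹⁰) ε²`" of
§6.7, here for `10⁻⁵ ≤ t ≤ T'` while `|c₀| ≤ K⁻¹⁰ε²` on `[0, T']`): by the landed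
`c_lower_of_affine_rate` applied to (6.131) with the affine bounds (6.147)/(6.157) on `b₀` and
`c₀(0) ≥ -(1+ε₀)^{-n₀/4}`. [cite: Tao2016AveragedNS, §6.7 (display before (6.158))] -/
theorem Setting.c_zero_lower (hs : Setting ε₀ K ε C₁ C₂ C₃ C₄ C₅ n₀ N ηp βp τ Y W F T ζ) {T' : ℝ}
    (hT' : T' ∈ Icc 0 T) (hP : ∀ s ∈ Icc 0 T', SmallC K ε Y s) {t : ℝ} (ht : t ∈ Icc 0 T')
    (ht5 : 1 / 10 ^ 5 ≤ t) :
    4 / 10 ^ 6 * ε ^ 2 *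
        Real.exp (K ^ 10 * (t ^ 2 / 2 - (1 / 10 ^ 5 + (K ^ 7)⁻¹) * t) - 1001 / 1000 * K ^ 10) ≤
      Y 2 0 t := by
  have hK := hs.K_pos
  have hε := hs.ε_pos
  have hε1 := hs.ε_le_one hε
  have hεK := hs.ε_le_K100
  have hτ₀ := hs.τ₀_le
  have hK7 : 0 < (K ^ 7)⁻¹ := by positivity
  have hK8 : 0 < (K ^ 8)⁻¹ := by positivity
  have hK7' : (K ^ 7)⁻¹ ≤ 1 := by
    have := hs.inv_pow_anti (n := 0) (m := 7) (by norm_num); simpa using this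
  have hK8q : (K ^ 8)⁻¹ ≤ 1 / 10 ^ 6 := by
    have := hs.inv_pow_succ_le 7; linarith
  have hK100 : (K ^ 100)⁻¹ ≤ 1 / 10 ^ 6 := by
    have h := hs.inv_pow_succ_le 99
    have h99 : (K ^ 99)⁻¹ ≤ 1 := by
      have := hs.inv_pow_anti (n := 0) (m := 99) (by norm_num); simpa using this
    linarith
  have hε6 : ε ≤ 1 / 10 ^ 6 := hεK.trans hK100
  have hε2 : ε ^ 2 ≤ 1 / 10 ^ 7 := by nlinarith
  have hρ : C₁ * (1 + ε₀) ^ (-(n₀ : ℝ) / 2) ≤ ε ^ 4 * Real.exp (-10 * K ^ 10) := hs.ρ_le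
  have hρ0 : 0 ≤ C₁ * (1 + ε₀) ^ (-(n₀ : ℝ) / 2) :=
    mul_nonneg hs.C₁_nn (Real.rpow_nonneg hs.q_pos.le _)
  set ρ := C₁ * (1 + ε₀) ^ (-(n₀ : ℝ) / 2) with hρdef
  set μ : ℝ := ε⁻¹ * K ^ 10 with hμ
  set p : ℝ := (1 / 10 ^ 5 + (K ^ 7)⁻¹) * ε with hp
  set lam₀ : ℝ := ε ^ 2 * Real.exp (-K ^ 10) * (1 - 2 * (K ^ 8)⁻¹) with hlam
  have he0 := Real.exp_pos (-K ^ 10)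
  have hE := mul_pos (pow_pos hε 2) he0
  have hlam0 : 0 ≤ lam₀ := by simp only [hlam]; apply mul_nonneg hE.le; linarith
  have hlam_ge : ε ^ 2 * Real.exp (-K ^ 10) * (1 / 2) ≤ lam₀ := by
    simp only [hlam]; apply mul_le_mul_of_nonneg_left _ hE.le; linarith
  -- `ρ ≤ ε² e^{-K¹⁰}/20`
  have hρsmall : ρ ≤ ε ^ 2 * Real.exp (-K ^ 10) * (1 / 20) := by
    have he : Real.exp (-10 * K ^ 10) ≤ Real.exp (-K ^ 10) := by
      apply Real.exp_le_exp.2; have := pow_nonneg hK.le 10; linarith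
    calc ρ ≤ ε ^ 4 * Real.exp (-10 * K ^ 10) := hρ
      _ = ε ^ 2 * Real.exp (-10 * K ^ 10) * ε ^ 2 := by ring
      _ ≤ ε ^ 2 * Real.exp (-K ^ 10) * (1 / 20) := by gcongr; linarith
  -- hypotheses of `c_lower_of_affine_rate`
  have hbound : ∀ x ∈ Ico 0 T', lam₀ + μ * Y 1 0 x * Y 2 0 x - ρ ≤ dY (τ (n₀ - N)) Y 2 0 x := by
    intro x hx
    have hxT' : x ∈ Icc 0 T' := Ico_subset_Icc_self hx
    have hxT : x ∈ Icc 0 T := ⟨hx.1, hx.2.le.trans hT'.2⟩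
    have h := hs.dc_zero hxT
    have ha := hs.sq_a_zero_ge hT' hP hxT'
    rw [abs_le] at h
    have : lam₀ ≤ ε ^ 2 * Real.exp (-K ^ 10) * Y 0 0 x ^ 2 := by
      simp only [hlam]; exact mul_le_mul_of_nonneg_left ha hE.le
    have e : μ * Y 1 0 x * Y 2 0 x = ε⁻¹ * K ^ 10 * Y 1 0 x * Y 2 0 x := by simp only [hμ]
    rw [e]
    linarith [h.1]
  have hblo : ∀ x ∈ Icc 0 T', ε * (x - 0) - p ≤ Y 1 0 x := by
    intro x hx
    have h := hs.b_zero_ge hT' hP hx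
    have hx100 : x ≤ 100 := (hx.2.trans hT'.2).trans hs.T_le
    have h87 : (K ^ 8)⁻¹ ≤ 1 / 10 ^ 6 * (K ^ 7)⁻¹ := hs.inv_pow_succ_le 7
    have hx0 := hx.1
    have h5 : 5 * (K ^ 8)⁻¹ * x ≤ (K ^ 7)⁻¹ := by nlinarith
    have h5' := mul_le_mul_of_nonneg_left h5 hε.le
    simp only [hp]
    nlinarith
  have hbhi : ∀ x ∈ Icc 0 T', Y 1 0 x ≤ ε * (x - 0) + p := by
    intro x hx
    have h := hs.abs_b_zero_le ⟨hx.1, hx.2.trans hT'.2⟩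
    rw [abs_le] at h
    simp only [hp]; linarith [h.2]
  have hca : -((1 + ε₀) ^ (-(n₀ : ℝ) / 4)) ≤ Y 2 0 0 := hs.hyp.c_ge
  have hle : ρ ≤ lam₀ := by linarith
  have hw0 : (0 : ℝ) < 1 / 10 ^ 5 := by norm_num
  have hwt : (1 : ℝ) / 10 ^ 5 ≤ t - 0 := by linarith
  -- the small exponent at the window `w = 10⁻⁵`
  have hexpw : Real.exp (-(1 / 1000 * K ^ 10)) ≤
      Real.exp (-(μ * (ε * (1 / 10 ^ 5) ^ 2 / 2 + p * (1 / 10 ^ 5)))) := by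
    apply Real.exp_le_exp.2
    have e : μ * (ε * (1 / 10 ^ 5) ^ 2 / 2 + p * (1 / 10 ^ 5)) =
        K ^ 10 * ((1 / 10 ^ 5) ^ 2 / 2 + (1 / 10 ^ 5 + (K ^ 7)⁻¹) * (1 / 10 ^ 5)) := by
      simp only [hμ, hp]; field_simp
    rw [e]
    have := pow_nonneg hK.le 10
    nlinarith
  -- the ignition quantity
  have hη : (1 + ε₀) ^ (-(n₀ : ℝ) / 4) ≤ 1 / 10 ^ 7 * ε ^ 2 * Real.exp (-(1001 / 1000 * K ^ 10)) := by
    have h4 : (1 + ε₀) ^ (-(n₀ : ℝ) / 4) ≤ ε ^ 4 * Real.exp (-10 * K ^ 10) :=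
      hs.q_n₀_quarter_le hs.ε₀_pos hs.C₁_nn hs.C₂_nn hs.C₅_nn
    have he : Real.exp (-10 * K ^ 10) ≤ Real.exp (-(1001 / 1000 * K ^ 10)) := by
      apply Real.exp_le_exp.2; have := pow_nonneg hK.le 10; nlinarith
    calc (1 + ε₀) ^ (-(n₀ : ℝ) / 4) ≤ ε ^ 4 * Real.exp (-10 * K ^ 10) := h4
      _ = ε ^ 2 * ε ^ 2 * Real.exp (-10 * K ^ 10) := by ring
      _ ≤ 1 / 10 ^ 7 * ε ^ 2 * Real.exp (-(1001 / 1000 * K ^ 10)) := by gcongr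
  have hsplit : Real.exp (-K ^ 10) * Real.exp (-(1 / 1000 * K ^ 10)) =
      Real.exp (-(1001 / 1000 * K ^ 10)) := by rw [← Real.exp_add]; congr 1; ring
  have hE0 := Real.exp_pos (-(1001 / 1000 * K ^ 10))
  have hE1 := Real.exp_pos (-(1 / 1000 * K ^ 10))
  have hX' : 4 / 10 ^ 6 * ε ^ 2 * Real.exp (-(1001 / 1000 * K ^ 10)) ≤
      (lam₀ - ρ) * (1 / 10 ^ 5) * Real.exp (-(μ * (ε * (1 / 10 ^ 5) ^ 2 / 2 + p * (1 / 10 ^ 5)))) -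
        (1 + ε₀) ^ (-(n₀ : ℝ) / 4) := by
    have hlr : ε ^ 2 * Real.exp (-K ^ 10) * (9 / 20) ≤ lam₀ - ρ := by linarith
    have hlr0 : 0 ≤ ε ^ 2 * Real.exp (-K ^ 10) * (9 / 20) := by positivity
    have key : ε ^ 2 * Real.exp (-K ^ 10) * (9 / 20) * (1 / 10 ^ 5) *
        Real.exp (-(1 / 1000 * K ^ 10)) ≤
        (lam₀ - ρ) * (1 / 10 ^ 5) * Real.exp (-(μ * (ε * (1 / 10 ^ 5) ^ 2 / 2 + p * (1 / 10 ^ 5)))) :=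
      mul_le_mul (mul_le_mul_of_nonneg_right hlr hw0.le) hexpw hE1.le
        (mul_nonneg (hlr0.trans hlr) hw0.le)
    have e : ε ^ 2 * Real.exp (-K ^ 10) * (9 / 20) * (1 / 10 ^ 5) *
        Real.exp (-(1 / 1000 * K ^ 10)) =
        9 / 20 * (1 / 10 ^ 5) * (ε ^ 2 * Real.exp (-(1001 / 1000 * K ^ 10))) := by
      rw [← hsplit]; ring
    rw [e] at key
    have hF := mul_pos (pow_pos hε 2) hE0
    linarith
  have hX : 0 ≤ (lam₀ - ρ) * (1 / 10 ^ 5) *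
      Real.exp (-(μ * (ε * (1 / 10 ^ 5) ^ 2 / 2 + p * (1 / 10 ^ 5)))) - (1 + ε₀) ^ (-(n₀ : ℝ) / 4) :=
    le_trans (by positivity) hX'
  have hmain := c_lower_of_affine_rate (σ := ε) (hs.continuousOn_Y 2 0 (b := T') hτ₀)
    (fun x hx => hs.hasDerivWithinAt_Y 2 0 (hτ₀.trans hx.1)) (hs.continuousOn_Y 1 0 hτ₀)
    (by positivity : (0:ℝ) ≤ μ) hbound hblo hbhi hε.le (by positivity) hca hle ht hw0 hwt hX
  -- the growth exponent
  have hexp : μ * (ε * (t - 0) ^ 2 / 2 - p * (t - 0)) =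
      K ^ 10 * (t ^ 2 / 2 - (1 / 10 ^ 5 + (K ^ 7)⁻¹) * t) := by
    simp only [hμ, hp, sub_zero]; field_simp
  rw [hexp] at hmain
  have hG := Real.exp_pos (K ^ 10 * (t ^ 2 / 2 - (1 / 10 ^ 5 + (K ^ 7)⁻¹) * t))
  calc 4 / 10 ^ 6 * ε ^ 2 *
        Real.exp (K ^ 10 * (t ^ 2 / 2 - (1 / 10 ^ 5 + (K ^ 7)⁻¹) * t) - 1001 / 1000 * K ^ 10)
      = Real.exp (K ^ 10 * (t ^ 2 / 2 - (1 / 10 ^ 5 + (K ^ 7)⁻¹) * t)) *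
          (4 / 10 ^ 6 * ε ^ 2 * Real.exp (-(1001 / 1000 * K ^ 10))) := by
        rw [sub_eq_add_neg, Real.exp_add]; ring
    _ ≤ Real.exp (K ^ 10 * (t ^ 2 / 2 - (1 / 10 ^ 5 + (K ^ 7)⁻¹) * t)) *
          ((lam₀ - ρ) * (1 / 10 ^ 5) *
              Real.exp (-(μ * (ε * (1 / 10 ^ 5) ^ 2 / 2 + p * (1 / 10 ^ 5)))) -
            (1 + ε₀) ^ (-(n₀ : ℝ) / 4)) :=
        mul_le_mul_of_nonneg_left hX' hG.le
    _ ≤ Y 2 0 t := hmain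

/-- **`t_c < 2`** (the source's (6.158) "`t_c ≤ 2` (say)"): at `t = 2` the ignition bound would
exceed `K⁻¹⁰ ε²`. [cite: Tao2016AveragedNS, §6.7 (6.158)] -/
theorem Setting.tc_lt_two (hs : Setting ε₀ K ε C₁ C₂ C₃ C₄ C₅ n₀ N ηp βp τ Y W F T ζ) : tc K ε Y T < 2 := by
  by_contra h2
  push Not at h2
  have htc := hs.tc_mem
  have hP : ∀ s ∈ Icc 0 (tc K ε Y T), SmallC K ε Y s := fun s hs' => hs.smallC_of_mem_tc hs'
  have h := hs.c_zero_lower htc hP (t := 2) ⟨by norm_num, h2⟩ (by norm_num)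
  have hc := hP 2 ⟨by norm_num, h2⟩
  unfold SmallC at hc
  rw [abs_le] at hc
  have hK := hs.K_pos
  have hε := hs.ε_pos
  have hK7 : (K ^ 7)⁻¹ ≤ 1 / 10 ^ 5 := by
    have := hs.inv_pow_succ_le 6
    have h6 : (K ^ 6)⁻¹ ≤ 1 := by
      have := hs.inv_pow_anti (n := 0) (m := 6) (by norm_num); simpa using this
    linarith
  -- the exponent at `t = 2` is ≥ (99/100) K¹⁰ ≥ 0, so the bound is ≥ 4·10⁻⁶ ε² e^{0} > K⁻¹⁰ ε²
  have hexp : 1 ≤ Real.exp (K ^ 10 * ((2 : ℝ) ^ 2 / 2 - (1 / 10 ^ 5 + (K ^ 7)⁻¹) * 2) -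
      1001 / 1000 * K ^ 10) := by
    apply Real.one_le_exp
    have := pow_nonneg hK.le 10
    nlinarith
  have hK10 : (K ^ 10)⁻¹ < 4 / 10 ^ 6 := by
    have h := hs.inv_pow_succ_le 9
    have h9 : (K ^ 9)⁻¹ ≤ 1 := by
      have := hs.inv_pow_anti (n := 0) (m := 9) (by norm_num); simpa using this
    linarith
  nlinarith [mul_pos (pow_pos hε 2) (by norm_num : (0:ℝ) < 4 / 10 ^ 6), hc.2,
    mul_le_mul_of_nonneg_left hexp (by positivity : (0:ℝ) ≤ 4 / 10 ^ 6 * ε ^ 2)]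

/-- `∫₀ᵗ a₁² ≤ 4.9·10⁵ K⁻²⁰ t` while `|c₀| ≤ K⁻¹⁰ ε²` on `[0, T']` (so the "forwards flow of energy"
exit `∫ a₁² = K^{-1/4}` of Cor. 6.14 does not occur before `t_c`).
[cite: Tao2016AveragedNS, §6.7 (before (6.154))] -/
theorem Setting.integral_a_one_sq_le (hs : Setting ε₀ K ε C₁ C₂ C₃ C₄ C₅ n₀ N ηp βp τ Y W F T ζ) {T' : ℝ}
    (hT' : T' ∈ Icc 0 T) (hP : ∀ s ∈ Icc 0 T', SmallC K ε Y s) {t : ℝ} (ht : t ∈ Icc 0 T') :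
    ∫ s in (0:ℝ)..t, Y 0 1 s ^ 2 ≤ (700 * (K ^ 10)⁻¹) ^ 2 * t := by
  have hτ₀ := hs.τ₀_le
  have hle : ∀ s ∈ Icc 0 t, Y 0 1 s ^ 2 ≤ (700 * (K ^ 10)⁻¹) ^ 2 := by
    intro s hs'
    have hda := hs.sqrt_da_le hT' hP ⟨hs'.1, hs'.2.trans ht.2⟩
    have h0 : 0 ≤ Y 3 0 s ^ 2 + Y 0 1 s ^ 2 := by positivity
    have := pow_le_pow_left₀ (Real.sqrt_nonneg _) hda 2
    rw [Real.sq_sqrt h0] at this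
    nlinarith [sq_nonneg (Y 3 0 s)]
  have hcont : ContinuousOn (fun s => Y 0 1 s ^ 2) (Icc 0 t) := (hs.continuousOn_Y 0 1 hτ₀).pow 2
  calc ∫ s in (0:ℝ)..t, Y 0 1 s ^ 2 ≤ ∫ s in (0:ℝ)..t, (700 * (K ^ 10)⁻¹) ^ 2 :=
        intervalIntegral.integral_mono_on ht.1 (hcont.intervalIntegrable_of_Icc ht.1)
          intervalIntegrable_const hle
    _ = (700 * (K ^ 10)⁻¹) ^ 2 * t := by simp [mul_comm]

/-- **`t_c < T`**: `t_c` is an exit by equality, not by running out of the interval `[0, T]` —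
each alternative of Cor. 6.14 at `T = t_c` is excluded (backwards flow by `F_negOne_lt_exit`,
forwards flow by `integral_a_one_sq_le`, `T = 100` by `t_c < 2`).
[cite: Tao2016AveragedNS, §6.7 (6.158)–(6.159)] -/
theorem Setting.tc_lt_T (hs : Setting ε₀ K ε C₁ C₂ C₃ C₄ C₅ n₀ N ηp βp τ Y W F T ζ)
    (hex : ExitTrichotomy ε₀ K Y F T) : tc K ε Y T < T := by
  have htc := hs.tc_mem
  rcases lt_or_eq_of_le htc.2 with hlt | heq
  · exact hlt
  exfalso
  have hP : ∀ s ∈ Icc 0 T, SmallC K ε Y s := fun s hs' =>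
    hs.smallC_of_mem_tc (by rw [heq]; exact hs')
  have hT : T ∈ Icc 0 T := ⟨hs.T_nn, le_rfl⟩
  rcases hex with h1 | h2 | h3
  · exact absurd h1 (ne_of_lt (hs.F_negOne_lt_exit hT hP hT))
  · have hint := hs.integral_a_one_sq_le hT hP hT
    have hK := hs.K_pos
    have hT100 := hs.T_le
    have hK10 : 0 < (K ^ 10)⁻¹ := by positivity
    have h10 : (K ^ 10)⁻¹ ≤ 1 / 10 ^ 6 * (K ^ 9)⁻¹ := hs.inv_pow_succ_le 9
    have h9 : (K ^ 9)⁻¹ ≤ 1 / 10 ^ 6 * (K ^ 8)⁻¹ := hs.inv_pow_succ_le 8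
    have h8 : (K ^ 8)⁻¹ ≤ (K ^ 1)⁻¹ := hs.inv_pow_anti (by norm_num)
    have hq : (K ^ 1)⁻¹ ≤ K ^ (-(1 : ℝ) / 4) := by
      rw [pow_one, ← Real.rpow_neg_one]
      exact Real.rpow_le_rpow_of_exponent_le hs.one_le_K (by norm_num)
    rw [h2] at hint
    have hq0 : 0 < K ^ (-(1 : ℝ) / 4) := Real.rpow_pos_of_pos hK _
    have h10' : (K ^ 10)⁻¹ ≤ 1 := by
      have := hs.inv_pow_anti (n := 0) (m := 10) (by norm_num); simpa using this
    have hsq : (700 * (K ^ 10)⁻¹) ^ 2 * T ≤ 49 * 10 ^ 6 * (K ^ 10)⁻¹ := by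
      calc (700 * (K ^ 10)⁻¹) ^ 2 * T ≤ (700 * (K ^ 10)⁻¹) ^ 2 * 100 := by gcongr
        _ = 49 * 10 ^ 6 * ((K ^ 10)⁻¹ * (K ^ 10)⁻¹) := by ring
        _ ≤ 49 * 10 ^ 6 * ((K ^ 10)⁻¹ * 1) := by gcongr
        _ = _ := by ring
    have hchain : (K ^ 10)⁻¹ ≤ 1 / 10 ^ 12 * K ^ (-(1 : ℝ) / 4) := by
      calc (K ^ 10)⁻¹ ≤ 1 / 10 ^ 6 * (K ^ 9)⁻¹ := h10
        _ ≤ 1 / 10 ^ 6 * (1 / 10 ^ 6 * (K ^ 8)⁻¹) := by gcongr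
        _ ≤ 1 / 10 ^ 6 * (1 / 10 ^ 6 * K ^ (-(1 : ℝ) / 4)) := by gcongr; exact h8.trans hq
        _ = _ := by ring
    nlinarith
  · have := hs.tc_lt_two; linarith

/-- **(6.151): `t_c ≥ 1/2`** (and hence `T > 1/2`, the source's (6.154)).
[cite: Tao2016AveragedNS, §6.7 (6.151), (6.154)] -/
theorem Setting.half_le_tc (hs : Setting ε₀ K ε C₁ C₂ C₃ C₄ C₅ n₀ N ηp βp τ Y W F T ζ)
    (hex : ExitTrichotomy ε₀ K Y F T) : 1 / 2 ≤ tc K ε Y T := by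
  have h1 := hs.min_le_tc
  have h2 := hs.tc_lt_T hex
  rcases le_total T (1 / 2) with h | h
  · rw [min_eq_left h] at h1; linarith
  · rwa [min_eq_right h] at h1

/-- **(6.159): `c₀(t_c) = K⁻¹⁰ ε²`** (exit by equality, continuity, and positivity of `c₀` from
the ignition bound). [cite: Tao2016AveragedNS, §6.7 (6.159)] -/
theorem Setting.c_zero_tc (hs : Setting ε₀ K ε C₁ C₂ C₃ C₄ C₅ n₀ N ηp βp τ Y W F T ζ)
    (hex : ExitTrichotomy ε₀ K Y F T) : Y 2 0 (tc K ε Y T) = (K ^ 10)⁻¹ * ε ^ 2 := by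
  have htc := hs.tc_mem
  have hlt := hs.tc_lt_T hex
  have hhalf := hs.half_le_tc hex
  have hP : ∀ s ∈ Icc 0 (tc K ε Y T), SmallC K ε Y s := fun s hs' => hs.smallC_of_mem_tc hs'
  have hsm := hP _ ⟨htc.1, le_rfl⟩
  unfold SmallC at hsm
  -- positivity
  have hpos : 0 < Y 2 0 (tc K ε Y T) := by
    have h := hs.c_zero_lower htc hP ⟨htc.1, le_rfl⟩ (by linarith)
    exact lt_of_lt_of_le (by have := hs.ε_pos; positivity) h
  -- not strictly inside
  have hge : (K ^ 10)⁻¹ * ε ^ 2 ≤ |Y 2 0 (tc K ε Y T)| := by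
    by_contra hlt'
    push Not at hlt'
    have hne := ODE.not_eventually_of_maximalTimeP_lt hs.T_nn hs.smallC_zero hlt
    apply hne
    have hcont : ContinuousWithinAt (fun u => |Y 2 0 u|) (Icc 0 T) (tc K ε Y T) :=
      ((hs.continuousOn_Y 2 0 (b := T) hs.τ₀_le).abs) _ htc
    have hev := Filter.Tendsto.eventually_lt_const hlt' hcont.tendsto
    exact hev.mono fun u hu => hu.le
  rw [abs_of_pos hpos] at hge hsm
  exact le_antisymm hsm hge

end Transition

end ZeroScale

end Tao2016AveragedNS

end Literature.Analysis.FluidPDE
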